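import Literature.NumberTheory.ComplexMultiplication.CMAlgebraLatticeContentFormula
import HarnessLib

/-!
# HERTLING–LARABI'S THEOREM 10.1 IN ITS PRINTED GENERALITY: for every full lattice `L` of an ARBITRARY
# finite-dimensional commutative `ℚ`-algebra `A` (nilpotents allowed), every power `L^k` with `k ≥ dim_ℚ A − 1` is
# invertible — by the content-formula proof, which needs neither HL's Theorem 10.2 nor Theorem 10.3

Topic `Literature/NumberTheory/ComplexMultiplication`, namespace
`Literature.NumberTheory.ComplexMultiplication.FiniteQAlgebraLattice`; lane `lit-hodgefound` (Track 2 foundations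
library), seat p19 generation 34, rows g34-#11 (§§1–3) and g34-#12 (§4); generation 35, rows g35-#1 (§§5–6: HL Thms. 10.3 (c)(d)
and 10.2 for general `A` as corollaries of Thm. 10.1) and g35-#2 (§7: HL26 Lemma 4.6 for general `A`, lattices inside orders) — sequel of g34-#2 (`CMAlgebraLatticeContentFormula`, the same theorem for
the lane's CM-algebras `Y = L_1 ⊕ ⋯ ⊕ L_t`, i.e. for SEPARABLE `A` = [DTZ62] Theorem C ∕ [Si70]).  THEOREMS ONLY: no
definition, no instance, no named fact (D-0026, net Literature debt `0`), no `sorry`; the lattice vocabulary is the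
tree's `Literature.NumberTheory.Automorphic.IsFullLattice A M` (`M` finitely generated with `ℚM = A`) and Mathlib's
semiring `Submodule ℤ A` (`M·N`, `M:N = M / N`, `𝒪(M) = M / M`); scalar units act as `ℤu·M = span ℤ {u} * M`.

## Source, VERBATIM

C. Hertling, K. Larabi, *Semigroups from full lattices in commutative ℚ-algebras*, arXiv:2602.14973 (2026)
[HertlingLarabi2026], Notations 1.5 (a) (chunk p0004): «Throughout the whole paper `A` is a finite dimensional
commutative ℚ-algebra with unit element `1_A`»; §10 (chunk p0026): «A main result in [DTZ62] is Theorem C in section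
1.5. It says that if `A` is an algebraic number field of dimension `n ∈ ℤ_{≥2}` then for each full lattice `L ∈ 𝓛(A)`
each power `L^k` with `k ≥ n−1` is invertible. This result was generalized in [Si70] to the case when `A` is
separable, so a direct sum of algebraic number fields. Here we generalize it further to the case of our standard
situation. **Theorem 10.1.** Let `A` be a commutative ℚ-algebra of dimension `n ∈ ℤ_{≥2}` with unit element `1_A`.
For each full lattice `L ∈ 𝓛(A)` each power `L^k` with `k ≥ n−1` is invertible. Our proof follows roughly the proof in
[DTZ62]. […] An important first step is Theorem 10.2 which is the analogue of [DTZ62] and which is of independent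
interest. In the case of an algebraic number field Theorem 10.2 and [DTZ62] become trivial. […] Our proof of
Theorem 10.2 is completely different from the proof of [DTZ62].»  And the last lines of the proof of Thm. 10.1
(chunk p0028): «`L^{n−1+l}` is invertible for `l ≥ 0` with `𝒪(L^{n−1+l}) = Λ_2`.»

## What is proved, and how (NOT HL's route)

For a commutative `ℚ`-algebra `A` with `Module.Finite ℚ A`, `n = finrank ℚ A`, and a full lattice `M`
(`IsFullLattice A M`):
* §1 lattice generalities valid in ANY `ℚ`-algebra: HL Thm. 7.2 (a) `M = ⋂_p M_(p)`
  (`mem_of_forall_prime_exists_coprime_smul_mem`); a finitely generated `ℤ`-submodule is spanned by `≤ n` elements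
  (`exists_finset_card_le_finrank_and_span_eq`); a full lattice has a `ℤ`-basis which is a `ℚ`-basis of `A`
  (`exists_basis_fin_span_eq`); the order calculus `1 ∈ M:M`, `(M:M)M = M`, `(M:M)(M:M) = M:M`, and HL Thm. 5.6 (c)
  «`ML_2 = 𝒪(M)` for some `L_2` ⟹ `M` invertible» (`mul_div_div_eq_of_exists_mul_eq_div_self`).
* §2 **THE CONTENT FORMULA IN `A`:** `c(f)^n·c(g) ⊆ c(f)^{n−1}·c(fg)` and `=` for ALL `f, g ∈ A[X]`, `ℤ`-contents
  (`content_pow_finrank_mul_le ∕ _eq`) — Heinzer–Huneke's Lemma 2.2 (g34-#1, any local `R`, any `R`-algebra) over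
  each `ℤ_(p)` (`c(g)` is spanned by `≤ n` elements), glued by §1.
* §3 **THEOREM 10.1 FOR `A`** (`exists_pow_succ_mul_eq_span_singleton_mul_pow`,
  **`exists_order_forall_pow_invertible`**, **`pow_mul_div_div_eq_of_isFullLattice`**, `pow_div_pow_eq_finrank_sub_one`):
  with a `ℤ`-basis `ω` of `M`, `f = ∑ ω_iX^i ∈ A[X]` is a non-zero-divisor with `c(f) = M`; its norm cofactor `g`
  (adjugate of the matrix of `f`, g34-#2 §1, any `K`-algebra with a finite basis) gives `fg = ν ∈ ℚ[X] ∖ 0`, and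
  `c(ν) = ℤu`, `u = c·1_A ∈ A^×`; §2 yields `M^n·N = ℤu·M^{n−1}` (`N = c(g)`), so `M^{k+1}N = ℤu·M^k` for `k ≥ n−1`;
  with `E := ℤu⁻¹·MN ∋ 1`: `E·M^k = M^k`, `E^{k+1} = E^k =: Λ_2` — an order — and `M^k·(ℤu^{−k}N^k) = Λ_2`, whence
  `M^k` is invertible with `𝒪(M^k) = Λ_2` for every `k ≥ n − 1`.  The radical of `A` never enters: HL need Theorem
  10.2 (an order `Λ ⊇ 𝒪(L)` with `ΛL` invertible, three pages for non-separable `A`) and Theorem 10.3; the content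
  formula needs neither, and the separable case of g34-#2 is the instance `A = ∏ Lᵢ`.
* §4 (row g34-#12) **THEOREM 1.3 (e) IN THE SEMIGROUP `W(𝓛(A))` OF WEAK CLASSES** (`L_1 ∼_w L_2` written
  `1 ∈ (L_1:L_2)(L_2:L_1)`, as in the `Y`-series): `∼_w` is symmetric and transitive in any `A`
  (`one_mem_div_mul_div_comm ∕ _trans`), an invertible lattice is `∼_w` its order
  (`one_mem_div_order_mul_order_div_of_mul_div_div_eq`), and for `M` full, `k, k' ≥ n − 1`: `M^k ∼_w 𝒪(M^k)`
  («`G(c) = [c]_w`»; `one_mem_pow_div_order_mul_order_div_pow`), `M^k ∼_w M^{k'}`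
  (`one_mem_pow_div_pow_mul_pow_div_pow`), `M^kM^k ∼_w M^k` (`one_mem_pow_mul_pow_div_pow_mul_pow_div_pow_mul_pow`).
* §5 (row g35-#1) **THEOREM 10.3 (c)(d) FOR GENERAL `A` AS A COROLLARY OF THEOREM 10.1**: for a full lattice `M` with
  `1_A ∈ M ⊆ Λ`, `Λ` an order, EVERY power `M^k`, `k ≥ n − 1`, is the order `Λ_2 = 𝒪(M^k) = 𝒪(M^{n−1})`
  (`pow_eq_pow_div_pow_of_one_mem_le_order`, `pow_eq_pow_finrank_sub_one_of_one_mem_le_order`,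
  `pow_isOrder_of_one_mem_le_order`): the stationary power of the chain `M ⊆ M² ⊆ ⋯ ⊆ Λ` (Noetherian) is an
  invertible (§3) idempotent, hence its own order, `= 𝒪(M^k) ⊆ M^k`; no `𝔽_p`-dimension count.  With Lemma 5.2 (a)
  for general `A` (`isFullLattice_mul ∕ _pow_succ ∕ _div`).
* §6 (row g35-#1) **THEOREM 10.2 FOR GENERAL `A` WITH THE MINIMAL ORDER** (`exists_minimal_order_mul_mem_G`,
  `exists_order_mul_mem_G`): `Λ_2 = 𝒪(M^k)`, `k ≥ max(1, n − 1)`, satisfies `Λ_2 ⊇ 𝒪(M)`, `𝒪(Λ_2M) = Λ_2`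
  (`pow_div_pow_mul_div_self_eq`), `Λ_2M` invertible (`pow_div_pow_mul_mul_inv_eq`: `Λ_2M·M^{k−1}(Λ_2:M^k) = Λ_2`), and
  lies in every order `Λ` with `ΛM ∈ G(Λ)` (`pow_div_pow_le_of_order_mul_mem_G`, via `G(Λ)` being closed under
  products, `mul_div_mul_eq_and_mul_inv_eq_of_invertible`); HL's two-page construction through the structure theorem
  `A = ⊕ (F^{(j)} ⊕ N^{(j)})` is bypassed, and the hypothesis `Λ ⊃ 𝒪(L)` of Thms. 10.2 ∕ 10.3 is seen to follow from
  `ΛL ∈ G(Λ)` (`div_self_le_of_order_mul_mem_G`).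
* §7 (row g35-#2) **HL26 LEMMA 4.6 FOR GENERAL `A`** (`pow_mul_div_div_ne_of_ne_pow`, any commutative ring, no fullness:
  the powers `M^j`, `1 ≤ j`, below the stationary one are NOT invertible, via §6's `G(Λ)`-product lemma), the
  minimal stationary index in `Nat.find` form (`pow_ne_pow_succ_of_lt_find`, `pow_mul_div_div_ne_of_lt_find`,
  `find_le_finrank_sub_one` = Thm. 10.3 (d) «`N ≤ n−1`»), and WHEN a lattice `M ∋ 1_A` lies in an order: iff its
  chain of powers is stationary (`exists_le_order_iff_exists_forall_pow_add_eq`, any ring), iff (`M` full, `n ≥ 2`)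
  `M·M^{n−1} = M^{n−1}` iff `M^{n−1}` is an order, `M^{n−1}` being then the least order above `M`
  (`exists_le_order_iff_mul_pow_eq_pow`).
NOT here: HL Thm. 10.3 (a) (needs Thm. 8.2 (b) for general `A`), Thm. 10.3 (b) (false as printed, g33-#3), the
`ε`-class semigroup `𝓔(A)` and the finiteness theorems for general `A`.

## References
* [HertlingLarabi2026] C. Hertling, K. Larabi, arXiv:2602.14973 (2026), Notations 1.5, §1 Lemma 1.2, §5 Lemma 5.2 (a),
  Lemma 5.3 (b), Thm. 5.6, §7 Thm. 7.2 (a), §10 Thms. 10.1, 10.2, 10.3. [cite: HertlingLarabi2026, §10 Thms. 10.1–10.3, chunks p0026–p0028]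
* [DadeTausskyZassenhaus1962] E. C. Dade, O. Taussky, H. Zassenhaus, Math. Ann. 148 (1962) 31–64, §1.5 Theorem C (as
  cited by HL 2026 §10; acq-11370). [cite: DadeTausskyZassenhaus1962, §1.5 Theorem C (as cited by HertlingLarabi2026 §10)]
* [HeinzerHuneke1998] W. Heinzer, C. Huneke, Proc. AMS 126 (1998) 1305–1309, Thm. 2.1 (reduction to `R_m`), Lemma 2.2.
  [cite: HeinzerHuneke1998, Thm. 2.1 and Lemma 2.2, p. 1307]
* [HertlingLarabi2026b] C. Hertling, K. Larabi, *Conjugacy classes of regular integer matrices*, arXiv:2602.15748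
  (2026), Lemma 4.6 (powers of a full lattice containing `1_A`; the non-invertible powers). [cite: HertlingLarabi2026b, Lemma 4.6, chunk p0007]
-/

noncomputable section

open scoped Classical Polynomial nonZeroDivisors
open Polynomial Submodule Module
open Literature.RingTheory.IntegralClosure.DedekindMertens
open Literature.NumberTheory.Automorphic (IsFullLattice)

namespace Literature.NumberTheory.ComplexMultiplication.FiniteQAlgebraLattice

variable {A : Type} [CommRing A]

/-! ## §1 Lattices in a commutative `ℚ`-algebra -/

/-- **HL THEOREM 7.2 (a), `L = ⋂_{p∈ℙ} L_(p)`, for ANY `ℤ`-submodule of ANY `ℚ`-algebra:** if for every prime `p` some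
integer prime to `p` multiplies `x` into `M`, then `x ∈ M` (the ideal `{k ∈ ℤ | kx ∈ M}` lies in no `pℤ`).
[cite: HertlingLarabi2026, §7 Thm. 7.2 (a), chunk p0018] -/
theorem mem_of_forall_prime_exists_coprime_smul_mem {M : Submodule ℤ A} {x : A}
    (h : ∀ p : ℕ, p.Prime → ∃ s : ℤ, ¬ (p : ℤ) ∣ s ∧ s • x ∈ M) : x ∈ M := by
  let I : Ideal ℤ := M.comap (LinearMap.toSpanSingleton ℤ A x)
  have hI : ∀ k : ℤ, k ∈ I ↔ k • x ∈ M := fun k => by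
    simp only [I, Submodule.mem_comap, LinearMap.toSpanSingleton_apply]
  obtain ⟨d, hd⟩ := (Submodule.IsPrincipal.principal I : ∃ d, I = Submodule.span ℤ {d})
  by_cases h1 : d.natAbs = 1
  · have hd1 : d ∣ 1 := Int.natAbs_dvd_natAbs.1 (by rw [h1, Int.natAbs_one])
    have h1I : (1 : ℤ) ∈ I := by rw [hd, Ideal.mem_span_singleton]; exact hd1
    have h1x := (hI 1).1 h1I
    rwa [one_smul] at h1x
  · obtain ⟨p, hp, hpd⟩ := Nat.exists_prime_and_dvd h1
    obtain ⟨s, hs, hsx⟩ := h p hp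
    have hsI : s ∈ I := (hI s).2 hsx
    rw [hd, Ideal.mem_span_singleton] at hsI
    exact (hs ((Int.natCast_dvd.2 hpd).trans hsI)).elim

/-- `ℤa·ℤb = ℤ(ab)`. [cite: HertlingLarabi2026, §1 («`aL`, `a ∈ A^{unit}`»), chunk p0003] -/
theorem span_singleton_mul_span_singleton (a b : A) : span ℤ {a} * span ℤ {b} = span ℤ {a * b} := by
  rw [Submodule.span_mul_span, Set.singleton_mul_singleton]

/-- `(ℤa)^k = ℤa^k`. [cite: HertlingLarabi2026, §4 (4.4), chunk p0009] -/
theorem span_singleton_pow (a : A) : ∀ k : ℕ, span ℤ {a} ^ k = span ℤ {a ^ k}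
  | 0 => by rw [pow_zero, pow_zero, Submodule.one_eq_span]
  | k + 1 => by rw [pow_succ, span_singleton_pow a k, span_singleton_mul_span_singleton, pow_succ]

/-- `1 ∈ 𝒪(M) = M:M`. [cite: HertlingLarabi2026, §1 («`𝒪(L) := L:L` is an order»), chunk p0003] -/
theorem one_mem_div_self (M : Submodule ℤ A) : (1 : A) ∈ M / M :=
  Submodule.mem_div_iff_forall_mul_mem.2 fun m hm => by rwa [one_mul]

/-- `𝒪(M)·M = M`. [cite: HertlingLarabi2026, §1, chunk p0003] -/
theorem div_self_mul_eq_self (M : Submodule ℤ A) : (M / M) * M = M := by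
  refine le_antisymm (Submodule.mul_le.2 fun a ha m hm => Submodule.mem_div_iff_forall_mul_mem.1 ha m hm)
    fun m hm => ?_
  rw [← one_mul m]
  exact Submodule.mul_mem_mul (one_mem_div_self M) hm

/-- `𝒪(M)·𝒪(M) = 𝒪(M)` (orders are idempotent). [cite: HertlingLarabi2026, §1 Lemma 1.2 (a), chunk p0003] -/
theorem div_self_mul_div_self (M : Submodule ℤ A) : (M / M) * (M / M) = M / M := by
  refine le_antisymm (Submodule.mul_le.2 fun a ha b hb => Submodule.mem_div_iff_forall_mul_mem.2 fun m hm => ?_)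
    fun a ha => ?_
  · rw [mul_assoc]
    exact Submodule.mem_div_iff_forall_mul_mem.1 ha _ (Submodule.mem_div_iff_forall_mul_mem.1 hb m hm)
  · rw [← mul_one a]
    exact Submodule.mul_mem_mul ha (one_mem_div_self M)

/-- `M·(𝒪(M):M) ⊆ 𝒪(M)` always. [cite: HertlingLarabi2026, §5 Thm. 5.6, chunk p0012] -/
theorem mul_div_div_le (M : Submodule ℤ A) : M * ((M / M) / M) ≤ M / M := by
  rw [mul_comm]
  exact Submodule.le_div_iff_mul_le.1 le_rfl

/-- **HL THEOREM 5.6 (c): if `M·L_2 = 𝒪(M)` for SOME `L_2`, then `M` is invertible, `M·(𝒪(M):M) = 𝒪(M)`.**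
[cite: HertlingLarabi2026, §5 Thm. 5.6 (c), chunk p0012] -/
theorem mul_div_div_eq_of_exists_mul_eq_div_self {M : Submodule ℤ A} (h : ∃ L₂ : Submodule ℤ A, M * L₂ = M / M) :
    M * ((M / M) / M) = M / M := by
  obtain ⟨L₂, hL₂⟩ := h
  refine le_antisymm (mul_div_div_le M) ?_
  have hle : L₂ ≤ (M / M) / M := Submodule.le_div_iff_mul_le.2 (by rw [mul_comm, hL₂])
  calc M / M = M * L₂ := hL₂.symm
    _ ≤ M * ((M / M) / M) := mul_le_mul' le_rfl hle

variable [Algebra ℚ A]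

/-- **A full lattice of `A` is `⊕_j ℤω_j` for a `ℚ`-basis `ω` of `A`** («A lattice `L` is a full lattice if and only if
`ℚ·L = V`»). [cite: HertlingLarabi2026, §2 Def. 2.1 (a), Lemma 2.2 (a), chunk p0005] -/
theorem exists_basis_fin_span_eq {M : Submodule ℤ A} (hM : IsFullLattice A M) :
    ∃ m : Basis (Fin (finrank ℚ A)) ℚ A, span ℤ (Set.range m) = M := by
  refine CMTypeLattice.exists_basis_span_eq_of_fg_of_forall_smul_mem (Fintype.card_fin _) M hM.1 fun x => ?_
  obtain ⟨n, hn, hnx⟩ := hM.2 x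
  refine ⟨n.natAbs, Int.natAbs_pos.2 hn, ?_⟩
  rcases Int.natAbs_eq n with h | h
  · rw [← h]
    exact hnx
  · rw [show (n.natAbs : ℤ) = -n by omega, neg_smul]
    exact M.neg_mem hnx

variable [Module.Finite ℚ A]

/-- **A finitely generated `ℤ`-submodule of `A` is spanned by at most `dim_ℚ A` elements** (free — torsion-free over
`ℤ` — with a `ℚ`-linearly independent `ℤ`-basis). [cite: HertlingLarabi2026, §2 Def. 2.1 (a) and Lemma 2.2 (a), chunk p0005] -/
theorem exists_finset_card_le_finrank_and_span_eq {N : Submodule ℤ A} (hN : N.FG) :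
    ∃ s : Finset A, s.card ≤ finrank ℚ A ∧ span ℤ (s : Set A) = N := by
  classical
  haveI : Module.Finite ℤ N := Module.Finite.iff_fg.2 hN
  haveI : IsAddTorsionFree A := IsAddTorsionFree.of_isTorsionFree ℚ A
  haveI : Module.IsTorsionFree ℤ N :=
    Function.Injective.moduleIsTorsionFree N.subtype Subtype.val_injective fun _ _ => rfl
  haveI : Module.Free ℤ N := Module.free_of_finite_type_torsion_free'
  let β := Module.Free.chooseBasis ℤ N
  have hli : LinearIndependent ℚ (fun k => (β k : A)) :=
    (LinearIndependent.iff_fractionRing ℤ ℚ).1 (β.linearIndependent.map' N.subtype (Submodule.ker_subtype N))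
  refine ⟨Finset.univ.image fun k => (β k : A), ?_, ?_⟩
  · calc (Finset.univ.image fun k => (β k : A)).card
        ≤ Fintype.card (Module.Free.ChooseBasisIndex ℤ N) := Finset.card_image_le.trans (by rw [Finset.card_univ])
      _ ≤ finrank ℚ A := hli.fintype_card_le_finrank
  · rw [Finset.coe_image, Finset.coe_univ, Set.image_univ]
    apply le_antisymm
    · rw [span_le]
      rintro _ ⟨k, rfl⟩
      exact (β k).2
    · intro x hx
      have h1 := β.sum_repr ⟨x, hx⟩
      have h2 := congrArg (fun y : N => (y : A)) h1
      simp only [Submodule.coe_sum, Submodule.coe_smul] at h2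
      rw [← h2]
      exact sum_mem fun k _ => smul_mem _ _ (subset_span ⟨k, rfl⟩)

/-! ## §2 The content formula `c(f)^n·c(g) = c(f)^{n−1}·c(fg)` for `ℤ`-contents in `A`, `n = dim_ℚ A` -/

/-- **THE DEDEKIND–MERTENS–HEINZER–HUNEKE FORMULA IN `A`: `c(f)^n·c(g) ⊆ c(f)^{n−1}·c(fg)` for ALL `f, g ∈ A[X]`**,
`n = dim_ℚ A`, `c(·) =` the `ℤ`-span of the coefficients: `c(g)` is spanned by `≤ n` elements, so over each local
ring `ℤ_(p)` HH Lemma 2.2 (g34-#1) applies, and «holds in `R` if and only if [it holds in] `R_m` for each maximal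
ideal» is §1's `p`-local membership. [cite: HeinzerHuneke1998, Thm. 2.1 (proof) and Lemma 2.2, p. 1307]
[cite: HertlingLarabi2026, §7 Def. 7.1, Thm. 7.2 (a), chunk p0018] -/
theorem content_pow_finrank_mul_le (f g : A[X]) :
    span ℤ (f.coeffs : Set A) ^ finrank ℚ A * span ℤ (g.coeffs : Set A) ≤
      span ℤ (f.coeffs : Set A) ^ (finrank ℚ A - 1) * span ℤ ((f * g).coeffs : Set A) := by
  classical
  obtain ⟨s, hs, hsg⟩ := exists_finset_card_le_finrank_and_span_eq (span_coeffs_fg (R := ℤ) g)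
  intro x hx
  refine mem_of_forall_prime_exists_coprime_smul_mem fun p hp => ?_
  haveI hP : (Ideal.span {(p : ℤ)}).IsPrime :=
    (Ideal.span_singleton_prime (by exact_mod_cast hp.ne_zero)).2 (Nat.prime_iff_prime_int.1 hp)
  set R₀ := Localization.subalgebra.ofField ℚ (Ideal.span {(p : ℤ)}).primeCompl
    (Ideal.primeCompl_le_nonZeroDivisors _) with hR₀
  haveI : IsLocalRing R₀ := IsLocalization.AtPrime.isLocalRing R₀ (Ideal.span {(p : ℤ)})
  have hs₀ : span R₀ (s : Set A) = span R₀ (g.coeffs : Set A) := by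
    rw [← Submodule.span_span_of_tower ℤ R₀ (s : Set A), hsg, Submodule.span_span_of_tower]
  have hloc := span_coeffs_pow_mul_le (R := R₀) f g s hs₀ hs
  have e₁ : span R₀ (f.coeffs : Set A) ^ finrank ℚ A * span R₀ (g.coeffs : Set A) =
      span R₀ (↑(span ℤ (f.coeffs : Set A) ^ finrank ℚ A * span ℤ (g.coeffs : Set A)) : Set A) := by
    rw [span_coe_mul, span_coe_pow, Submodule.span_span_of_tower, Submodule.span_span_of_tower]
  have e₂ : span R₀ (f.coeffs : Set A) ^ (finrank ℚ A - 1) * span R₀ ((f * g).coeffs : Set A) =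
      span R₀ (↑(span ℤ (f.coeffs : Set A) ^ (finrank ℚ A - 1) * span ℤ ((f * g).coeffs : Set A)) : Set A) := by
    rw [span_coe_mul, span_coe_pow, Submodule.span_span_of_tower, Submodule.span_span_of_tower]
  have hx₁ : x ∈ span R₀ (↑(span ℤ (f.coeffs : Set A) ^ (finrank ℚ A - 1) *
      span ℤ ((f * g).coeffs : Set A)) : Set A) := by
    rw [← e₂]
    exact hloc (e₁ ▸ subset_span hx)
  obtain ⟨s', hs', hmem⟩ := exists_mem_smul_mem_of_mem_span_ofField _ _ _ hx₁
  exact ⟨s', fun hdvd => hs' (Ideal.mem_span_singleton.2 hdvd), hmem⟩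

/-- **The content formula in `A` as an EQUALITY: `c(f)^n·c(g) = c(f)^{n−1}·c(fg)`**, `n = dim_ℚ A ≥ 1`.
[cite: HeinzerHuneke1998, Thm. 2.1, p. 1307] -/
theorem content_pow_finrank_mul_eq (f g : A[X]) (hn : 1 ≤ finrank ℚ A) :
    span ℤ (f.coeffs : Set A) ^ finrank ℚ A * span ℤ (g.coeffs : Set A) =
      span ℤ (f.coeffs : Set A) ^ (finrank ℚ A - 1) * span ℤ ((f * g).coeffs : Set A) := by
  refine le_antisymm (content_pow_finrank_mul_le f g) ?_
  calc span ℤ (f.coeffs : Set A) ^ (finrank ℚ A - 1) * span ℤ ((f * g).coeffs : Set A)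
      ≤ span ℤ (f.coeffs : Set A) ^ (finrank ℚ A - 1) * (span ℤ (f.coeffs : Set A) * span ℤ (g.coeffs : Set A)) :=
        mul_le_mul' le_rfl (span_coeffs_mul_le f g)
    _ = _ := by rw [← mul_assoc, ← pow_succ, Nat.sub_add_cancel hn]

/-! ## §3 HL Theorem 10.1 for `A`: `M^k` is invertible for every full lattice `M` and every `k ≥ dim_ℚ A − 1` -/

/-- **THE STRUCTURE BEHIND THEOREM 10.1: for a full lattice `M` of `A`, `n = dim_ℚ A ≥ 1`, there are a lattice `N` and a
unit `u ∈ A^×` with `u ∈ MN` and `M^{k+1}·N = ℤu·M^k` for all `k ≥ n − 1`** (`N = c(g)` for the norm cofactor `g` of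
`f = ∑ ω_iX^i`, `ω` a `ℤ`-basis of `M`; `ℤu = c(fg)`; §2 gives `M^nN = ℤu·M^{n−1}`).
[cite: HertlingLarabi2026, §10 Thm. 10.1, chunk p0026] [cite: HeinzerHuneke1998, Lemma 2.2, p. 1307] -/
theorem exists_pow_succ_mul_eq_span_singleton_mul_pow {M : Submodule ℤ A} (hM : IsFullLattice A M)
    (hn : 1 ≤ finrank ℚ A) :
    ∃ (N : Submodule ℤ A) (u : Aˣ), (u : A) ∈ M * N ∧
      ∀ k : ℕ, finrank ℚ A - 1 ≤ k → M ^ (k + 1) * N = span ℤ {(u : A)} * M ^ k := by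
  classical
  set n := finrank ℚ A with hn_def
  obtain ⟨ω, hω⟩ := exists_basis_fin_span_eq hM
  obtain ⟨g, ν, hν, hfg⟩ := exists_mul_sum_C_mul_X_pow_eq_map ω
  obtain ⟨c, hc, hcν⟩ := exists_span_coeffs_map_eq_span_singleton (A := A) ν hν
  set f : A[X] := ∑ i : Fin n, C (ω i) * X ^ (i : ℕ) with hf
  have hcf : span ℤ (f.coeffs : Set A) = M := by rw [hf, span_coeffs_sum_C_mul_X_pow, hω]
  set u : Aˣ := Units.map (algebraMap ℚ A : ℚ →* A) (Units.mk0 c hc) with hu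
  have hu' : (u : A) = algebraMap ℚ A c := by rw [hu, Units.coe_map, Units.val_mk0]; rfl
  have hcfg : span ℤ ((f * g).coeffs : Set A) = span ℤ {(u : A)} := by rw [hfg, hcν, hu']
  set N := span ℤ (g.coeffs : Set A) with hN
  have hle : M ^ n * N ≤ span ℤ {(u : A)} * M ^ (n - 1) := by
    have h := content_pow_finrank_mul_le f g
    rwa [hcf, hcfg, mul_comm (M ^ (n - 1))] at h
  have huMN : (u : A) ∈ M * N := by
    have h := span_coeffs_mul_le (R := ℤ) f g
    rw [hcf, hcfg, span_singleton_le_iff_mem] at h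
    exact h
  have hge : span ℤ {(u : A)} * M ^ (n - 1) ≤ M ^ n * N := by
    rw [mul_comm]
    calc M ^ (n - 1) * span ℤ {(u : A)} ≤ M ^ (n - 1) * (M * N) :=
        mul_le_mul' le_rfl ((span_singleton_le_iff_mem _ _).2 huMN)
      _ = M ^ n * N := by rw [← mul_assoc, ← pow_succ, Nat.sub_add_cancel hn]
  have hstar : M ^ n * N = span ℤ {(u : A)} * M ^ (n - 1) := le_antisymm hle hge
  refine ⟨N, u, huMN, fun k hk => ?_⟩
  obtain ⟨j, rfl⟩ := Nat.exists_eq_add_of_le hk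
  calc M ^ (n - 1 + j + 1) * N = M ^ j * (M ^ n * N) := by
        rw [mul_comm (M ^ j), mul_assoc, mul_comm N, ← mul_assoc, ← pow_add]
        congr 2
        omega
    _ = span ℤ {(u : A)} * M ^ (n - 1 + j) := by rw [hstar, mul_left_comm, ← pow_add, add_comm]

/-- **HERTLING–LARABI THEOREM 10.1 FOR AN ARBITRARY FINITE-DIMENSIONAL COMMUTATIVE `ℚ`-ALGEBRA `A`, WITH THE COMMON
ORDER OF THE HIGH POWERS: for a full lattice `M`, `n = dim_ℚ A ≥ 1`, there is an order `Λ_2` (`1 ∈ Λ_2 = Λ_2Λ_2`) with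
`M^k·(𝒪(M^k):M^k) = 𝒪(M^k) = Λ_2` for every `k ≥ n − 1`** («For each full lattice `L ∈ 𝓛(A)` each power `L^k` with
`k ≥ n−1` is invertible», «`𝒪(L^{n−1+l}) = Λ_2`»).  `Λ_2 = E^k`, `E = ℤu⁻¹·MN ∋ 1`, `E·M^k = M^k`, `E^{k+1} = E^k`,
`M^k·ℤu^{−k}N^k = Λ_2`. [cite: HertlingLarabi2026, §10 Thm. 10.1 and end of its proof, chunks p0026–p0028]
[cite: DadeTausskyZassenhaus1962, §1.5 Theorem C (as cited by HertlingLarabi2026 §10)] -/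
theorem exists_order_forall_pow_invertible {M : Submodule ℤ A} (hM : IsFullLattice A M)
    (hn : 1 ≤ finrank ℚ A) :
    ∃ Λ₂ : Submodule ℤ A, (1 : A) ∈ Λ₂ ∧ Λ₂ * Λ₂ = Λ₂ ∧
      ∀ k : ℕ, finrank ℚ A - 1 ≤ k → M ^ k * ((M ^ k / M ^ k) / M ^ k) = M ^ k / M ^ k ∧ M ^ k / M ^ k = Λ₂ := by
  classical
  set n := finrank ℚ A with hn_def
  obtain ⟨N, u, huMN, hstar⟩ := exists_pow_succ_mul_eq_span_singleton_mul_pow hM hn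
  set E : Submodule ℤ A := span ℤ {((u⁻¹ : Aˣ) : A)} * (M * N) with hE
  -- `1 ∈ E`
  have h1E : (1 : A) ∈ E := by
    have h := Submodule.mul_mem_mul (mem_span_singleton_self ((u⁻¹ : Aˣ) : A)) huMN
    rwa [Units.inv_mul] at h
  -- `E·M^k = M^k` for `k ≥ n-1`
  have hEM : ∀ k, n - 1 ≤ k → E * M ^ k = M ^ k := fun k hk => by
    have h1 : E * M ^ k = span ℤ {((u⁻¹ : Aˣ) : A)} * (M ^ (k + 1) * N) := by rw [hE]; ring
    rw [h1, hstar k hk, ← mul_assoc, span_singleton_mul_span_singleton, Units.inv_mul, ← Submodule.one_eq_span,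
      one_mul]
  -- `E^k = ℤu^{-k}·(M^kN^k)`
  have hEpow : ∀ k, E ^ k = span ℤ {((u⁻¹ : Aˣ) : A) ^ k} * (M ^ k * N ^ k) := fun k => by
    rw [hE, mul_pow, mul_pow, span_singleton_pow]
  -- `E^{k+1} = E^k` for `k ≥ n-1`
  have hEstab : ∀ k, n - 1 ≤ k → E ^ (k + 1) = E ^ k := fun k hk => by
    have h1 : E ^ (k + 1) = span ℤ {((u⁻¹ : Aˣ) : A) ^ (k + 1)} * ((M ^ (k + 1) * N) * N ^ k) := by
      rw [hEpow]; ring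
    rw [h1, hstar k hk, hEpow]
    calc span ℤ {((u⁻¹ : Aˣ) : A) ^ (k + 1)} * (span ℤ {(u : A)} * M ^ k * N ^ k)
        = (span ℤ {((u⁻¹ : Aˣ) : A) ^ (k + 1)} * span ℤ {(u : A)}) * (M ^ k * N ^ k) := by ring
      _ = span ℤ {((u⁻¹ : Aˣ) : A) ^ k} * (M ^ k * N ^ k) := by
        rw [span_singleton_mul_span_singleton, pow_succ, mul_assoc, Units.inv_mul, mul_one]
  have hEstab' : ∀ k, n - 1 ≤ k → ∀ j, E ^ (k + j) = E ^ k := fun k hk j => by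
    induction j with
    | zero => rw [add_zero]
    | succ j ih => rw [← add_assoc, hEstab _ (hk.trans (Nat.le_add_right k j)), ih]
  have h1Ek : ∀ k, (1 : A) ∈ E ^ k := fun k => by
    induction k with
    | zero => rw [pow_zero]; exact Submodule.one_le.mp le_rfl
    | succ k ih => rw [pow_succ]; simpa only [mul_one] using Submodule.mul_mem_mul ih h1E
  have hEkM : ∀ k, n - 1 ≤ k → ∀ j, E ^ j * M ^ k = M ^ k := fun k hk j => by
    induction j with
    | zero => rw [pow_zero, one_mul]
    | succ j ih => rw [pow_succ, mul_assoc, hEM k hk, ih]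
  refine ⟨E ^ (n - 1), h1Ek _, ?_, fun k hk => ?_⟩
  · rw [← pow_add, hEstab' _ le_rfl]
  · set Λ₂ := E ^ k with hΛ₂
    have hΛk : E ^ (n - 1) = Λ₂ := by
      obtain ⟨j, rfl⟩ := Nat.exists_eq_add_of_le hk
      rw [hΛ₂, hEstab' _ le_rfl]
    have hΛΛ : Λ₂ * Λ₂ = Λ₂ := by rw [hΛ₂, ← pow_add, hEstab' _ hk]
    have h1Λ : (1 : A) ∈ Λ₂ := h1Ek k
    have hΛM : Λ₂ * M ^ k = M ^ k := hEkM k hk k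
    have hML : M ^ k * (span ℤ {((u⁻¹ : Aˣ) : A) ^ k} * N ^ k) = Λ₂ := by
      rw [hΛ₂, hEpow]; ring
    have hΛO : Λ₂ ≤ M ^ k / M ^ k := Submodule.le_div_iff_mul_le.2 hΛM.le
    have hΛOO : Λ₂ * (M ^ k / M ^ k) = M ^ k / M ^ k := by
      refine le_antisymm ?_ fun x hx => ?_
      · calc Λ₂ * (M ^ k / M ^ k) ≤ (M ^ k / M ^ k) * (M ^ k / M ^ k) := mul_le_mul' hΛO le_rfl
          _ = M ^ k / M ^ k := div_self_mul_div_self _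
      · rw [← one_mul x]
        exact Submodule.mul_mem_mul h1Λ hx
    have hinv : M ^ k * ((M ^ k / M ^ k) / M ^ k) = M ^ k / M ^ k :=
      mul_div_div_eq_of_exists_mul_eq_div_self
        ⟨span ℤ {((u⁻¹ : Aˣ) : A) ^ k} * N ^ k * (M ^ k / M ^ k), by rw [← mul_assoc, hML, hΛOO]⟩
    refine ⟨hinv, ?_⟩
    rw [hΛk]
    refine le_antisymm (fun x hx => ?_) hΛO
    have h2 : x * 1 ∈ (M ^ k / M ^ k) * Λ₂ := Submodule.mul_mem_mul hx h1Λ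
    rw [mul_one, ← hML, ← mul_assoc, div_self_mul_eq_self] at h2
    rwa [← hML]

/-- **HERTLING–LARABI THEOREM 10.1 AS PRINTED: `A` any finite-dimensional commutative `ℚ`-algebra, `M` any full
lattice, `k ≥ dim_ℚ A − 1` ⟹ `M^k` is invertible, `M^k·(𝒪(M^k):M^k) = 𝒪(M^k)`** («Let `A` be a commutative
ℚ-algebra of dimension `n ∈ ℤ_{≥2}` with unit element `1_A`. For each full lattice `L ∈ 𝓛(A)` each power `L^k` with
`k ≥ n−1` is invertible»; `n ≤ 1` is trivial and included). [cite: HertlingLarabi2026, §10 Thm. 10.1, chunk p0026]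
[cite: DadeTausskyZassenhaus1962, §1.5 Theorem C (as cited by HertlingLarabi2026 §10)] -/
theorem pow_mul_div_div_eq_of_isFullLattice {M : Submodule ℤ A} (hM : IsFullLattice A M) {k : ℕ}
    (hk : finrank ℚ A - 1 ≤ k) : M ^ k * ((M ^ k / M ^ k) / M ^ k) = M ^ k / M ^ k := by
  rcases Nat.eq_zero_or_pos (finrank ℚ A) with h0 | hn
  · haveI : Subsingleton A := Module.finrank_zero_iff.1 h0
    exact Subsingleton.elim _ _
  · obtain ⟨Λ₂, -, -, h⟩ := exists_order_forall_pow_invertible hM hn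
    exact (h k hk).1

/-- The orders of all high powers coincide: `𝒪(M^k) = 𝒪(M^{n−1})` for `k ≥ n − 1` («`𝒪(L^{n−1+l}) = Λ_2`»).
[cite: HertlingLarabi2026, §10 end of the proof of Thm. 10.1, chunk p0028] -/
theorem pow_div_pow_eq_finrank_sub_one {M : Submodule ℤ A} (hM : IsFullLattice A M) {k : ℕ} (hk : finrank ℚ A - 1 ≤ k) :
    M ^ k / M ^ k = M ^ (finrank ℚ A - 1) / M ^ (finrank ℚ A - 1) := by
  rcases Nat.eq_zero_or_pos (finrank ℚ A) with h0 | hn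
  · haveI : Subsingleton A := Module.finrank_zero_iff.1 h0
    exact Subsingleton.elim _ _
  · obtain ⟨Λ₂, -, -, h⟩ := exists_order_forall_pow_invertible hM hn
    rw [(h k hk).2, (h _ le_rfl).2]

/-! ## §4 Theorem 1.3 (e) in the semigroup `W(𝓛(A))` of weak classes, general `A` (row g34-#12)

HL §1 (chunk p0003): «`a ∼_w b ⟺ a = b` or `∃ x_1, x_2 ∈ S` with `ax_1 = b`, `bx_2 = a`. Then `W(S) := S/∼_w` is a
quotient semigroup, and for an idempotent `c ∈ S` `G(c) = [c]_w`», Lemma 1.2 (a) «The idempotents in `𝓛(A)` are the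
orders»; weak equivalence of lattices is written `1 ∈ (L_1:L_2)·(L_2:L_1)` as in the `Y`-series
(`CMAlgebraLatticeWeakEquivalence`, HL Thm. 4.4 ∕ 5.7: `L_1 ∼_w L_2 ⟺ 1 ∈ (L_1:L_2)(L_2:L_1)`). -/

omit [Algebra ℚ A] [Module.Finite ℚ A] in
/-- `(A:B)(B:C) ⊆ A:C`. [cite: HertlingLarabi2026, §4 Thm. 4.4 (a) (proof), chunk p0009] -/
theorem div_mul_div_le_div (P Q T : Submodule ℤ A) : (P / Q) * (Q / T) ≤ P / T := by
  refine Submodule.le_div_iff_mul_le.2 ?_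
  rw [mul_assoc]
  calc (P / Q) * ((Q / T) * T) ≤ (P / Q) * Q := mul_le_mul' le_rfl (Submodule.le_div_iff_mul_le.1 le_rfl)
    _ ≤ P := Submodule.le_div_iff_mul_le.1 le_rfl

omit [Algebra ℚ A] [Module.Finite ℚ A] in
/-- `∼_w` is symmetric. [cite: HertlingLarabi2026, §4 Thm. 4.4 (a), chunk p0009] -/
theorem one_mem_div_mul_div_comm (M N : Submodule ℤ A) :
    (1 : A) ∈ (M / N) * (N / M) ↔ (1 : A) ∈ (N / M) * (M / N) := by
  rw [mul_comm]

omit [Algebra ℚ A] [Module.Finite ℚ A] in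
/-- `∼_w` is transitive: `1 = 1·1 ∈ ((A:B)(B:A))((B:C)(C:B)) ⊆ (A:C)(C:A)`. [cite: HertlingLarabi2026, §4 Thm. 4.4 (a), chunk p0009] -/
theorem one_mem_div_mul_div_trans {P Q T : Submodule ℤ A} (hPQ : (1 : A) ∈ (P / Q) * (Q / P))
    (hQT : (1 : A) ∈ (Q / T) * (T / Q)) : (1 : A) ∈ (P / T) * (T / P) := by
  have h1 : (1 : A) * 1 ∈ ((P / Q) * (Q / P)) * ((Q / T) * (T / Q)) := Submodule.mul_mem_mul hPQ hQT
  rw [mul_one, mul_mul_mul_comm, mul_comm (Q / P) (T / Q)] at h1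
  exact mul_le_mul' (div_mul_div_le_div P Q T) (div_mul_div_le_div T Q P) h1

omit [Algebra ℚ A] [Module.Finite ℚ A] in
/-- **An invertible lattice is weakly equivalent to its order: `M·(𝒪(M):M) = 𝒪(M) ⟹ 1 ∈ (M:𝒪(M))·(𝒪(M):M)`**
(`M ⊆ M:𝒪(M)` and `1 ∈ 𝒪(M) = M(𝒪(M):M)`; the easy half of HL Thm. 4.4 (b) ∕ 5.8 (b) «`G(Λ) = [Λ]_w`»).
[cite: HertlingLarabi2026, §4 Thm. 4.4 (b), §5 Thm. 5.8 (b) (5.11), chunks p0009, p0013] -/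
theorem one_mem_div_order_mul_order_div_of_mul_div_div_eq {M : Submodule ℤ A}
    (hinv : M * ((M / M) / M) = M / M) : (1 : A) ∈ (M / (M / M)) * ((M / M) / M) := by
  have h1 : (1 : A) ∈ M * ((M / M) / M) := by rw [hinv]; exact one_mem_div_self _
  have hle : M ≤ M / (M / M) :=
    Submodule.le_div_iff_mul_le.2 (by rw [mul_comm]; exact (div_self_mul_eq_self _).le)
  exact mul_le_mul' hle le_rfl h1

/-- **THEOREM 1.3 (e) IN `W(𝓛(A))`, GENERAL `A`: for a full lattice `M` and `k ≥ dim_ℚ A − 1`, `M^k ∼_w 𝒪(M^k)` — the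
weak class of `M^k` is the group `G(𝒪(M^k)) = [𝒪(M^k)]_w` of an idempotent** («for an idempotent `c`, `G(c) = [c]_w`»;
HL's proof of Thm. 10.1 ends «`L^{n−1+l} ∼_w L_2^{n−1+l} = Λ_2`»). [cite: HertlingLarabi2026, §1 Thm. 1.3 (e) with Lemma 1.2, chunk p0003; §10 Thm. 10.1 (end of proof), chunk p0028] -/
theorem one_mem_pow_div_order_mul_order_div_pow {M : Submodule ℤ A} (hM : IsFullLattice A M) {k : ℕ}
    (hk : finrank ℚ A - 1 ≤ k) :
    (1 : A) ∈ (M ^ k / (M ^ k / M ^ k)) * ((M ^ k / M ^ k) / M ^ k) :=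
  one_mem_div_order_mul_order_div_of_mul_div_div_eq (pow_mul_div_div_eq_of_isFullLattice hM hk)

/-- **All high powers are weakly equivalent: `M^k ∼_w M^{k'}` for `k, k' ≥ dim_ℚ A − 1`** (both `∼_w Λ_2 =
𝒪(M^k) = 𝒪(M^{k'})`). [cite: HertlingLarabi2026, §10 Thm. 10.1 (end of proof), chunk p0028; §4 Thm. 4.4 (a), chunk p0009] -/
theorem one_mem_pow_div_pow_mul_pow_div_pow {M : Submodule ℤ A} (hM : IsFullLattice A M) {k k' : ℕ}
    (hk : finrank ℚ A - 1 ≤ k) (hk' : finrank ℚ A - 1 ≤ k') :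
    (1 : A) ∈ (M ^ k / M ^ k') * (M ^ k' / M ^ k) := by
  have h := one_mem_pow_div_order_mul_order_div_pow hM hk
  have h' := one_mem_pow_div_order_mul_order_div_pow hM hk'
  rw [pow_div_pow_eq_finrank_sub_one hM hk] at h
  rw [pow_div_pow_eq_finrank_sub_one hM hk'] at h'
  exact one_mem_div_mul_div_trans h ((one_mem_div_mul_div_comm _ _).1 h')

/-- **The weak class of a high power is idempotent: `M^kM^k ∼_w M^k` for `k ≥ dim_ℚ A − 1`** (Thm. 4.4 (c) «`L`
invertible ⟺ `LL ∼_w L`» read through Thm. 10.1; here `M^kM^k = M^{2k}`, `2k ≥ k`).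
[cite: HertlingLarabi2026, §4 Thm. 4.4 (c) with §10 Thm. 10.1, chunks p0009–p0010, p0026] -/
theorem one_mem_pow_mul_pow_div_pow_mul_pow_div_pow_mul_pow {M : Submodule ℤ A} (hM : IsFullLattice A M) {k : ℕ}
    (hk : finrank ℚ A - 1 ≤ k) :
    (1 : A) ∈ ((M ^ k * M ^ k) / M ^ k) * (M ^ k / (M ^ k * M ^ k)) := by
  rw [← pow_add]
  exact one_mem_pow_div_pow_mul_pow_div_pow hM (hk.trans (Nat.le_add_right k k)) hk

/-! ## §5 Theorem 10.3 (c)(d) for general `A`: for a full lattice `M` with `1_A ∈ M ⊆ Λ`, `Λ` an order, EVERY power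
`M^k` with `k ≥ dim_ℚ A − 1` IS the order `Λ_2 = 𝒪(M^{n−1})` (row g35-#1)

HL §10 Thm. 10.3 (chunk p0027), VERBATIM: «Let `A` be a commutative ℚ-algebra with unit element `1_A` of dimension
`n ∈ ℤ_{≥2}`. Let `L ∈ 𝓛(A)` be a full lattice. Let `Λ` be an order with `Λ ⊃ 𝒪(L)` and `ΛL ∈ G(Λ)`. […] (b) A full
lattice `L_2 ∈ 𝓛(A)` with `L_2 ∼_w L`, `1_A ∈ L_2` and `L_2 ⊂ Λ` exists. (c) The full lattice `L_2` in part (b)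
satisfies: (i) The sequence `(L_2^l)_{l∈ℕ}` of full lattices is increasing and becomes stationary, so there is a
minimal number `N ∈ ℕ` with `L_2^N = L_2^{N+l}` for each `l ≥ 0`. (ii) `Λ_2 := L_2^N` is an order with
`Λ_2 ⊃ 𝒪(L)`. (d) In part (c) `N ≤ n−1`.»  HL prove (d) by counting `𝔽_p`-dimensions along
`(L_2^l + pΛ_2)/pΛ_2` and Nakayama (chunk p0028; the `Y`-series file `CMAlgebraLatticePowersInvertible`, g33-#1,
formalises that count for `Y = ∏ L_i`).  HERE, FOR GENERAL `A`, (d) IS A COROLLARY OF THEOREM 10.1 (§3) and no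
residue field enters: the chain `M ⊆ M² ⊆ ⋯ ⊆ Λ` is stationary at some `M^N` (`Λ` is a Noetherian `ℤ`-module), an
idempotent containing `1_A`; the power `M^{N+k} = M^N`, `k ≥ n − 1`, is moreover invertible (§3), and an invertible
idempotent lattice is its own order (`eq_div_self_of_mul_self_eq_of_mul_div_div_eq`: `𝒪 = M·𝒪:M = MM·𝒪:M = M𝒪 =
M`); all the orders `𝒪(M^k)`, `k ≥ n − 1`, coincide (§3), and `𝒪(M^k) ⊆ M^k ⊆ M^{N+k}` because `1_A ∈ M^k` — so
`M^k = 𝒪(M^k) = Λ_2` for EVERY `k ≥ n − 1` (`pow_eq_pow_div_pow_of_one_mem_le_order`).  The only use of `Λ` is that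
the powers of `M` are bounded (necessary: in `A = ℚ²`, `M = ℤ(1,1) + ℤ(½,0) ∋ 1_A` is full and `M ≠ 𝒪(M)`).  Part (b)
is false as printed (`CMAlgebraLatticeWeakClassWithoutUnitRepresentative`, g33-#3: `A = ℚ³`, `Λ = ℤ³`, the even-sum
lattice) and is not used here.  First, Lemma 5.2 (a) for general `A`: products, powers and quotients of full
lattices are full. -/

open Literature.NumberTheory.Automorphic (mem_units_smul_submodule_iff exists_smul_mem_of_fg)
open scoped Pointwise

omit [Algebra ℚ A] [Module.Finite ℚ A] in
/-- **HL LEMMA 5.2 (a) for general `A` (indeed any commutative ring): `L_1L_2` is a full lattice** (finitely generated, and `(nk)·d = (n·d)(k·1_A) ∈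
L_1L_2`). [cite: HertlingLarabi2026, §5 Lemma 5.2 (a), chunk p0011] -/
theorem isFullLattice_mul {M N : Submodule ℤ A} (hM : IsFullLattice A M) (hN : IsFullLattice A N) :
    IsFullLattice A (M * N) := by
  refine ⟨hM.1.mul hN.1, fun d => ?_⟩
  obtain ⟨n, hn, hnd⟩ := hM.2 d
  obtain ⟨k, hk, hk1⟩ := hN.2 1
  refine ⟨n * k, mul_ne_zero hn hk, ?_⟩
  have h1 : (n * k) • d = (n • d) * (k • (1 : A)) := by
    rw [zsmul_eq_mul, zsmul_eq_mul, zsmul_eq_mul, mul_one, Int.cast_mul]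
    ring
  rw [h1]
  exact Submodule.mul_mem_mul hnd hk1

omit [Algebra ℚ A] [Module.Finite ℚ A] in
/-- Positive powers of a full lattice are full lattices («The sequence `(L_2^l)_{l∈ℕ}` of full lattices»).
[cite: HertlingLarabi2026, §5 Lemma 5.2 (a), chunk p0011; §10 Thm. 10.3 (c)(i), chunk p0027] -/
theorem isFullLattice_pow_succ {M : Submodule ℤ A} (hM : IsFullLattice A M) :
    ∀ m : ℕ, IsFullLattice A (M ^ (m + 1))
  | 0 => by rwa [zero_add, pow_one]
  | m + 1 => by rw [pow_succ]; exact isFullLattice_mul (isFullLattice_pow_succ hM m) hM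

omit [Module.Finite ℚ A] in
/-- **HL LEMMA 5.2 (a) for general `A`: `L_1 : L_2` is a full lattice** — it lies in `(k·1_A)⁻¹L_1` for
`k·1_A ∈ L_2`, `k ∈ ℤ ∖ 0` (a unit of the `ℚ`-algebra `A`), and `n·d ∈ L_1:L_2` as soon as `n(dL_2) ⊆ L_1`; in
particular every order `𝒪(L) = L:L` of a full lattice is a full lattice. [cite: HertlingLarabi2026, §5 Lemma 5.2 (a) (with Lemma 2.3 (a)), chunk p0011] -/
theorem isFullLattice_div {M N : Submodule ℤ A} (hM : IsFullLattice A M) (hN : IsFullLattice A N) :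
    IsFullLattice A (M / N) := by
  refine ⟨?_, fun d => ?_⟩
  · obtain ⟨k, hk, hk1⟩ := hN.2 1
    have hku : IsUnit (k • (1 : A)) := by
      rw [zsmul_eq_mul, mul_one, ← map_intCast (algebraMap ℚ A) k]
      exact (((Int.cast_ne_zero (α := ℚ)).2 hk).isUnit).map _
    have hle : M / N ≤ hku.unit⁻¹ • M := fun a ha => by
      rw [mem_units_smul_submodule_iff, inv_inv, Units.smul_def, IsUnit.unit_spec, smul_eq_mul, mul_comm]
      exact (Submodule.mem_div_iff_forall_mul_mem.1 ha) _ hk1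
    refine Submodule.FG.of_le ?_ hle
    rw [Units.smul_def]
    exact hM.1.map _
  · have hdN : (d • N).FG := hN.1.map _
    obtain ⟨n, hn, hnM⟩ := exists_smul_mem_of_fg hM hdN
    refine ⟨n, hn, Submodule.mem_div_iff_forall_mul_mem.2 fun y hy => ?_⟩
    rw [smul_mul_assoc]
    exact hnM _ (Submodule.smul_mem_pointwise_smul y d N hy)

omit [Algebra ℚ A] [Module.Finite ℚ A] in
/-- `1_A ∈ M ⟹ M^m ⊆ M^{m+1}` («The sequence `(L_2^l)_{l∈ℕ}` is increasing because of `1_A ∈ L_2`»).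
[cite: HertlingLarabi2026, §10 Thm. 10.3 (c)(i) (proof), chunk p0028] -/
theorem pow_le_pow_succ_of_one_mem {M : Submodule ℤ A} (h1 : (1 : A) ∈ M) (m : ℕ) : M ^ m ≤ M ^ (m + 1) :=
  fun x hx => by
  rw [pow_succ, ← mul_one x]
  exact Submodule.mul_mem_mul hx h1

omit [Algebra ℚ A] [Module.Finite ℚ A] in
/-- `1_A ∈ M ⟹ (M^m)_m` is increasing. [cite: HertlingLarabi2026, §10 Thm. 10.3 (c)(i), chunk p0027] -/
theorem pow_le_pow_of_one_mem {M : Submodule ℤ A} (h1 : (1 : A) ∈ M) {a b : ℕ} (hab : a ≤ b) : M ^ a ≤ M ^ b := by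
  induction hab with
  | refl => exact le_rfl
  | step _ ih => exact ih.trans (pow_le_pow_succ_of_one_mem h1 _)

omit [Algebra ℚ A] [Module.Finite ℚ A] in
/-- `1_A ∈ M ⟹ 1_A ∈ M^m` («`1_A ∈ L_2^N`»). [cite: HertlingLarabi2026, §10 Thm. 10.3 (c)(ii) (proof), chunk p0028] -/
theorem one_mem_pow_of_one_mem {M : Submodule ℤ A} (h1 : (1 : A) ∈ M) : ∀ m : ℕ, (1 : A) ∈ M ^ m
  | 0 => by rw [pow_zero]; exact Submodule.one_le.1 le_rfl
  | m + 1 => by rw [pow_succ, ← mul_one (1 : A)]; exact Submodule.mul_mem_mul (one_mem_pow_of_one_mem h1 m) h1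

omit [Algebra ℚ A] [Module.Finite ℚ A] in
/-- `M ⊆ Λ`, `Λ` an order ⟹ `M^m ⊆ Λ` for every `m` («because each `L_2^l ⊂ Λ`»).
[cite: HertlingLarabi2026, §10 Thm. 10.3 (c)(i) (proof), chunk p0028] -/
theorem pow_le_of_le_order {M Λ : Submodule ℤ A} (h1Λ : (1 : A) ∈ Λ) (hΛΛ : Λ * Λ ≤ Λ) (hMΛ : M ≤ Λ) :
    ∀ m : ℕ, M ^ m ≤ Λ
  | 0 => by rw [pow_zero]; exact Submodule.one_le.2 h1Λ
  | m + 1 => by rw [pow_succ]; exact (mul_le_mul' (pow_le_of_le_order h1Λ hΛΛ hMΛ m) hMΛ).trans hΛΛ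

omit [Algebra ℚ A] [Module.Finite ℚ A] in
/-- `1_A ∈ M ⟹ 𝒪(M) ⊆ M` (`x = x·1_A`). [cite: HertlingLarabi2026, §10 Thm. 10.3 (a) (proof: «Especially `L_1 ⊂ Λ` because `1_A ∈ Λ`»), chunk p0028] -/
theorem div_self_le_of_one_mem {M : Submodule ℤ A} (h1 : (1 : A) ∈ M) : M / M ≤ M := fun x hx => by
  have h := (Submodule.mem_div_iff_forall_mul_mem.1 hx) 1 h1
  rwa [mul_one] at h

omit [Algebra ℚ A] [Module.Finite ℚ A] in
/-- An order is idempotent: `1_A ∈ Λ`, `ΛΛ ⊆ Λ ⟹ ΛΛ = Λ` («Because of `1 ∈ Λ`, we have `ΛΛ = Λ`»).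
[cite: HertlingLarabi2026, §1 Lemma 1.2 (a) («The idempotents in `𝓛(A)` are the orders»), chunk p0003] -/
theorem mul_self_eq_of_one_mem {Λ : Submodule ℤ A} (h1 : (1 : A) ∈ Λ) (hmul : Λ * Λ ≤ Λ) : Λ * Λ = Λ :=
  le_antisymm hmul fun x hx => by simpa only [mul_one] using Submodule.mul_mem_mul hx h1

omit [Algebra ℚ A] [Module.Finite ℚ A] in
/-- `Λ^{j+1} = Λ` for an order `Λ`. [cite: HertlingLarabi2026, §1 Lemma 1.2 (a), chunk p0003] -/
theorem pow_succ_eq_self_of_one_mem {Λ : Submodule ℤ A} (h1 : (1 : A) ∈ Λ) (hmul : Λ * Λ ≤ Λ) :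
    ∀ j : ℕ, Λ ^ (j + 1) = Λ
  | 0 => pow_one Λ
  | j + 1 => by rw [pow_succ, pow_succ_eq_self_of_one_mem h1 hmul j, mul_self_eq_of_one_mem h1 hmul]

omit [Algebra ℚ A] [Module.Finite ℚ A] in
/-- An order is its own order: `1_A ∈ Λ`, `ΛΛ ⊆ Λ ⟹ 𝒪(Λ) = Λ:Λ = Λ`. [cite: HertlingLarabi2026, §1 Lemma 1.2 (a), chunk p0003] -/
theorem div_self_eq_of_one_mem {Λ : Submodule ℤ A} (h1 : (1 : A) ∈ Λ) (hmul : Λ * Λ ≤ Λ) : Λ / Λ = Λ :=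
  le_antisymm (div_self_le_of_one_mem h1) (Submodule.le_div_iff_mul_le.2 hmul)

omit [Algebra ℚ A] [Module.Finite ℚ A] in
/-- **An order is invertible: `Λ·(𝒪(Λ):Λ) = 𝒪(Λ)`** (all three lattices are `Λ`). [cite: HertlingLarabi2026, §5 Thm. 5.6 (a), chunk p0012] -/
theorem mul_div_div_eq_of_one_mem_of_mul_le {Λ : Submodule ℤ A} (h1 : (1 : A) ∈ Λ) (hmul : Λ * Λ ≤ Λ) :
    Λ * ((Λ / Λ) / Λ) = Λ / Λ := by
  rw [div_self_eq_of_one_mem h1 hmul, div_self_eq_of_one_mem h1 hmul, mul_self_eq_of_one_mem h1 hmul]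

omit [Algebra ℚ A] [Module.Finite ℚ A] in
/-- **AN INVERTIBLE IDEMPOTENT LATTICE IS ITS OWN ORDER: `MM = M` and `M·(𝒪(M):M) = 𝒪(M)` ⟹ `M = 𝒪(M)`**
(`𝒪(M) = M·(𝒪(M):M) = MM·(𝒪(M):M) = M·𝒪(M) = M`: «for each idempotent `c` the set `G(c)` […] is a group with unit
element `c`», and the idempotents of `𝓛(A)` are the orders). [cite: HertlingLarabi2026, §1 (definition of `G(c)`) and Lemma 1.2 (a), chunk p0003] -/
theorem eq_div_self_of_mul_self_eq_of_mul_div_div_eq {M : Submodule ℤ A} (hMM : M * M = M)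
    (hinv : M * ((M / M) / M) = M / M) : M = M / M :=
  calc M = (M / M) * M := (div_self_mul_eq_self M).symm
    _ = M * ((M / M) / M) * M := by rw [hinv]
    _ = M * M * ((M / M) / M) := by ring
    _ = M / M := by rw [hMM, hinv]

omit [Algebra ℚ A] [Module.Finite ℚ A] in
/-- **THM. 10.3 (c)(i) for general `A`: for `1_A ∈ M ⊆ Λ`, `Λ` a finitely generated `ℤ`-module closed under
multiplication, the increasing chain `M ⊆ M² ⊆ ⋯` becomes stationary, `M^{N+l} = M^N` for all `l`** («It becomes
stationary at some `L_2^N` because each `L_2^l ⊂ Λ`»: `Λ` is a Noetherian `ℤ`-module). [cite: HertlingLarabi2026, §10 Thm. 10.3 (c)(i), chunks p0027–p0028] -/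
theorem exists_forall_pow_add_eq {M Λ : Submodule ℤ A} (hΛ : Λ.FG) (h1Λ : (1 : A) ∈ Λ) (hΛΛ : Λ * Λ ≤ Λ)
    (h1 : (1 : A) ∈ M) (hMΛ : M ≤ Λ) : ∃ N : ℕ, ∀ l : ℕ, M ^ (N + l) = M ^ N := by
  haveI : IsNoetherian ℤ Λ := isNoetherian_of_fg_of_noetherian _ hΛ
  let a : ℕ →o Submodule ℤ Λ :=
    ⟨fun m => (M ^ m).comap Λ.subtype, fun i j hij => Submodule.comap_mono (pow_le_pow_of_one_mem h1 hij)⟩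
  obtain ⟨N, hN⟩ := monotone_stabilizes_iff_noetherian.2 inferInstance a
  have key : ∀ m, (a m).map Λ.subtype = M ^ m := fun m => by
    change ((M ^ m).comap Λ.subtype).map Λ.subtype = M ^ m
    rw [Submodule.map_comap_eq, Submodule.range_subtype, inf_eq_right.2 (pow_le_of_le_order h1Λ hΛΛ hMΛ m)]
  refine ⟨N, fun l => ?_⟩
  calc M ^ (N + l) = (a (N + l)).map Λ.subtype := (key _).symm
    _ = (a N).map Λ.subtype := by rw [hN (N + l) (Nat.le_add_right N l)]
    _ = M ^ N := key N

omit [Algebra ℚ A] [Module.Finite ℚ A] in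
/-- Once stationary, always: `M^m = M^N` for `m ≥ N`. [cite: HertlingLarabi2026, §10 Thm. 10.3 (c)(i), chunk p0027] -/
theorem pow_eq_pow_of_le {M : Submodule ℤ A} {N m : ℕ} (hstab : ∀ l : ℕ, M ^ (N + l) = M ^ N) (h : N ≤ m) :
    M ^ m = M ^ N := by
  obtain ⟨l, rfl⟩ := Nat.exists_eq_add_of_le h
  exact hstab l

omit [Algebra ℚ A] [Module.Finite ℚ A] in
/-- **THM. 10.3 (c)(ii): the stationary power `Λ_2 := M^N` is an ORDER** — `1_A ∈ M^N`, `M^N·M^N = M^N`, `M·M^N =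
M^N`, `𝒪(M^N) = M^N` («`Λ_2 := L_2^N` is an order because `1_A ∈ L_2^N` and `L_2^N·L_2^N = L_2^N`»).
[cite: HertlingLarabi2026, §10 Thm. 10.3 (c)(ii), chunks p0027–p0028] -/
theorem pow_isOrder_of_forall_pow_add_eq {M : Submodule ℤ A} (h1 : (1 : A) ∈ M) {N : ℕ}
    (hstab : ∀ l : ℕ, M ^ (N + l) = M ^ N) :
    (1 : A) ∈ M ^ N ∧ M ^ N * M ^ N = M ^ N ∧ M * M ^ N = M ^ N ∧ M ^ N / M ^ N = M ^ N := by
  have hmul : M ^ N * M ^ N = M ^ N := by rw [← pow_add, hstab]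
  refine ⟨one_mem_pow_of_one_mem h1 N, hmul, ?_, div_self_eq_of_one_mem (one_mem_pow_of_one_mem h1 N) hmul.le⟩
  rw [mul_comm, ← pow_succ, hstab 1]

/-- **HL THEOREM 10.3 (c)(d) FOR AN ARBITRARY FINITE-DIMENSIONAL COMMUTATIVE `ℚ`-ALGEBRA `A` — EVERY HIGH POWER IS THE
ORDER `Λ_2`: for a full lattice `M` with `1_A ∈ M ⊆ Λ`, `Λ` an order (finitely generated, `ΛΛ ⊆ Λ`), and every
`k ≥ dim_ℚ A − 1`: `M^k = 𝒪(M^k)`** (`= Λ_2 = 𝒪(M^{n−1})` by §3).  Proof through Theorem 10.1, not through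
`Λ_2/pΛ_2`: `M^{N+k} = M^N` is an invertible (§3) idempotent, hence `= 𝒪(M^{N+k}) = 𝒪(M^k) ⊆ M^k ⊆ M^{N+k}`.
(`dim_ℚ A ≤ 1` is included: then `k ≥ 0` and `M^0 = ℤ1_A = 𝒪(M^0)`.) [cite: HertlingLarabi2026, §10 Thm. 10.3 (c)(d), chunks p0027–p0028]
[cite: DadeTausskyZassenhaus1962, §1.5 Theorem C (as cited by HertlingLarabi2026 §10)] -/
theorem pow_eq_pow_div_pow_of_one_mem_le_order {M Λ : Submodule ℤ A} (hM : IsFullLattice A M) (h1 : (1 : A) ∈ M)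
    (hΛ : Λ.FG) (hΛΛ : Λ * Λ ≤ Λ) (hMΛ : M ≤ Λ) {k : ℕ} (hk : finrank ℚ A - 1 ≤ k) :
    M ^ k = M ^ k / M ^ k := by
  obtain ⟨N, hstab⟩ := exists_forall_pow_add_eq hΛ (hMΛ h1) hΛΛ h1 hMΛ
  have hNk : finrank ℚ A - 1 ≤ N + k := hk.trans (Nat.le_add_left k N)
  -- the stationary power `M^{N+k} = M^N` is an invertible idempotent, hence its own order
  have hj : M ^ (N + k) = M ^ (N + k) / M ^ (N + k) := by
    refine eq_div_self_of_mul_self_eq_of_mul_div_div_eq ?_ (pow_mul_div_div_eq_of_isFullLattice hM hNk)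
    rw [← pow_add, show N + k + (N + k) = N + (k + N + k) from by ring, hstab, hstab]
  -- and all the orders `𝒪(M^j)`, `j ≥ n − 1`, coincide (§3)
  have hO : M ^ (N + k) / M ^ (N + k) = M ^ k / M ^ k := by
    rw [pow_div_pow_eq_finrank_sub_one hM hNk, pow_div_pow_eq_finrank_sub_one hM hk]
  refine le_antisymm ?_ (div_self_le_of_one_mem (one_mem_pow_of_one_mem h1 k))
  calc M ^ k ≤ M ^ (N + k) := pow_le_pow_of_one_mem h1 (Nat.le_add_left k N)
    _ = M ^ k / M ^ k := hj.trans hO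

/-- **THM. 10.3 (d) AS PRINTED, general `A`: `N ≤ n − 1` — all the powers `M^k`, `k ≥ dim_ℚ A − 1`, COINCIDE:
`M^k = M^{n−1}`** («The number `N_0 := max_{p∈P_0} N_p ≤ n−1` satisfies […] `L_2^{N_0+l} = Λ_2` for `l ≥ 0`»).  Sharp
(`L ⊊ L² ⊊ ⋯ ⊊ L^{n−1}` for Dedekind's `L = ⟨1, a, 2a², …, 2a^{n−1}⟩`: `CMAlgebraLatticePowersInvertibleSharp`).
[cite: HertlingLarabi2026, §10 Thm. 10.3 (d) and end of its proof, chunks p0027–p0028] [cite: DadeTausskyZassenhaus1962, §1.5 Theorem C (as cited by HertlingLarabi2026 §10)] -/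
theorem pow_eq_pow_finrank_sub_one_of_one_mem_le_order {M Λ : Submodule ℤ A} (hM : IsFullLattice A M)
    (h1 : (1 : A) ∈ M) (hΛ : Λ.FG) (hΛΛ : Λ * Λ ≤ Λ) (hMΛ : M ≤ Λ) {k : ℕ} (hk : finrank ℚ A - 1 ≤ k) :
    M ^ k = M ^ (finrank ℚ A - 1) := by
  rw [pow_eq_pow_div_pow_of_one_mem_le_order hM h1 hΛ hΛΛ hMΛ hk,
    pow_eq_pow_div_pow_of_one_mem_le_order hM h1 hΛ hΛΛ hMΛ le_rfl, pow_div_pow_eq_finrank_sub_one hM hk]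

/-- **THM. 10.3 (c)(d) ASSEMBLED, general `A`: for `1_A ∈ M ⊆ Λ` as above and every `k ≥ dim_ℚ A − 1`, `M^k` is an
ORDER — `1_A ∈ M^k`, `M^kM^k = M^k`, `M·M^k = M^k`, `𝒪(M^k) = M^k` —, it is INVERTIBLE, and it is a full lattice**
(«`Λ_2 := L_2^N` is an order», «`L_2^{n−1+l} = Λ_2` for `l ≥ 0`»). [cite: HertlingLarabi2026, §10 Thm. 10.3 (c)(d) and proof of Thm. 10.1, chunks p0027–p0028] -/
theorem pow_isOrder_of_one_mem_le_order {M Λ : Submodule ℤ A} (hM : IsFullLattice A M) (h1 : (1 : A) ∈ M)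
    (hΛ : Λ.FG) (hΛΛ : Λ * Λ ≤ Λ) (hMΛ : M ≤ Λ) {k : ℕ} (hk : finrank ℚ A - 1 ≤ k) :
    (1 : A) ∈ M ^ k ∧ M ^ k * M ^ k = M ^ k ∧ M * M ^ k = M ^ k ∧ M ^ k / M ^ k = M ^ k ∧
      M ^ k * ((M ^ k / M ^ k) / M ^ k) = M ^ k / M ^ k ∧ IsFullLattice A (M ^ k) := by
  have hstab : ∀ l : ℕ, M ^ (k + l) = M ^ k := fun l => by
    rw [pow_eq_pow_finrank_sub_one_of_one_mem_le_order hM h1 hΛ hΛΛ hMΛ hk,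
      pow_eq_pow_finrank_sub_one_of_one_mem_le_order hM h1 hΛ hΛΛ hMΛ (hk.trans (Nat.le_add_right k l))]
  obtain ⟨h1k, hkk, hMk, hOk⟩ := pow_isOrder_of_forall_pow_add_eq h1 hstab
  have hMle : M ≤ M ^ k := fun x hx => by
    rw [← hMk, ← mul_one x]
    exact Submodule.mul_mem_mul hx h1k
  exact ⟨h1k, hkk, hMk, hOk, pow_mul_div_div_eq_of_isFullLattice hM hk,
    (hM.1.pow k), fun d => (hM.2 d).imp fun n hn => ⟨hn.1, hMle hn.2⟩⟩

/-- **THM. 10.3 (c)(ii), the clause `Λ_2 ⊃ 𝒪(L)`, general `A`: `𝒪(M) ⊆ M^k = Λ_2` for `k ≥ dim_ℚ A − 1`**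
(`𝒪(M)·M^k = 𝒪(M)·M·M^k = M·M^k = M^k`). [cite: HertlingLarabi2026, §10 Thm. 10.3 (c)(ii), chunk p0027] -/
theorem div_self_le_pow_of_one_mem_le_order {M Λ : Submodule ℤ A} (hM : IsFullLattice A M) (h1 : (1 : A) ∈ M)
    (hΛ : Λ.FG) (hΛΛ : Λ * Λ ≤ Λ) (hMΛ : M ≤ Λ) {k : ℕ} (hk : finrank ℚ A - 1 ≤ k) : M / M ≤ M ^ k := by
  obtain ⟨-, -, hMk, hOk, -, -⟩ := pow_isOrder_of_one_mem_le_order hM h1 hΛ hΛΛ hMΛ hk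
  rw [← hOk]
  refine Submodule.le_div_iff_mul_le.2 (le_of_eq ?_)
  calc M / M * M ^ k = M / M * (M * M ^ k) := by rw [hMk]
    _ = M ^ k := by rw [← mul_assoc, div_self_mul_eq_self, hMk]

/-- **The stationary order is the common order of §3: `M^k = 𝒪(M^{k'})` for all `k, k' ≥ dim_ℚ A − 1`** («`Λ_2`»
of Thm. 10.3 = «`Λ_2 = 𝒪(L^{n−1+l})`» of the proof of Thm. 10.1). [cite: HertlingLarabi2026, §10 Thm. 10.3 (c)(ii) and end of the proof of Thm. 10.1, chunks p0027–p0028] -/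
theorem pow_eq_pow_div_pow_of_one_mem_le_order' {M Λ : Submodule ℤ A} (hM : IsFullLattice A M) (h1 : (1 : A) ∈ M)
    (hΛ : Λ.FG) (hΛΛ : Λ * Λ ≤ Λ) (hMΛ : M ≤ Λ) {k k' : ℕ} (hk : finrank ℚ A - 1 ≤ k)
    (hk' : finrank ℚ A - 1 ≤ k') : M ^ k = M ^ k' / M ^ k' := by
  rw [pow_eq_pow_div_pow_of_one_mem_le_order hM h1 hΛ hΛΛ hMΛ hk, pow_div_pow_eq_finrank_sub_one hM hk,
    pow_div_pow_eq_finrank_sub_one hM hk']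

/-! ## §6 Theorem 10.2 for general `A`, with the MINIMAL witness `Λ = Λ_2 = 𝒪(M^{n−1})` (row g35-#1)

HL §10 Thm. 10.2 (chunk p0026), VERBATIM: «Let `A` be a finite dimensional commutative ℚ-algebra with unit element
`1_A`. Let `L ∈ 𝓛(A)` be a full lattice. An order `Λ ⊃ 𝒪(L)` with `ΛL ∈ G(Λ)` (so `𝒪(ΛL) = Λ` and `ΛL` invertible)
exists.»  And: «An important first step is Theorem 10.2 which is the analogue of [DTZ62, 1.3] and which is of
independent interest. In the case of an algebraic number field Theorem 10.2 and [DTZ62, 1.3] become trivial. Then one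
can choose `Λ = Λ_max`. Our proof of Theorem 10.2 is completely different from the proof of [DTZ62]» — two pages
through the structure theorem `A = ⊕_j (F^{(j)} ⊕ N^{(j)})` and hand-built lattices `B^{(j,l)}_ℤ` (chunks
p0026–p0027).  HERE IT IS A COROLLARY OF THEOREM 10.1 (§3) with an EXPLICIT, CANONICAL and MINIMAL witness: the common
order `Λ_2 = 𝒪(M^k)` (`k ≥ n − 1`, `k ≥ 1`) of the high powers works — (i) `𝒪(M) ⊆ 𝒪(M^k)` always; (ii)
`𝒪(Λ_2M) = Λ_2`: `⊇` as `Λ_2Λ_2 = Λ_2`, `⊆` as `𝒪(Λ_2M)·M^k = 𝒪(Λ_2M)·(Λ_2M)·M^{k−1} ⊆ Λ_2M·M^{k−1} = Λ_2M^k = M^k`;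
(iii) `Λ_2M·(M^{k−1}·(Λ_2:M^k)) = Λ_2·(M^k·(Λ_2:M^k)) = Λ_2Λ_2 = Λ_2 = 𝒪(Λ_2M)`, so `Λ_2M` is invertible by Thm. 5.6
(c); (iv) MINIMALITY: if `Λ` is ANY order with `ΛM ∈ G(Λ)` then, `G(Λ)` being a group, `(ΛM)^j = ΛM^j ∈ G(Λ)` and
`𝒪(M^j) ⊆ 𝒪(ΛM^j) = Λ` for every `j ≥ 1` — for `j = 1` this says that the hypothesis `Λ ⊃ 𝒪(L)` of Theorems 10.2 ∕
10.3 is implied by `ΛL ∈ G(Λ)`, and for `j = n − 1` that `Λ_2 ⊆ Λ`, as in the last lines of HL's proof of Thm. 10.1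
(«`Λ_2 = L_2^N ⊂ Λ`», «`𝒪(L^{n−1+l}) = Λ_2`»). -/

omit [Algebra ℚ A] [Module.Finite ℚ A] in
/-- `𝒪(P) ⊆ 𝒪(QP)` («`Λ_1(L_1L_2) = (Λ_1L_1)L_2 = L_1L_2` shows `Λ_1 ⊂ 𝒪(L_1L_2)`», `Λ_1 = 𝒪(L_1)`).
[cite: HertlingLarabi2026, §5 Lemma 5.3 (b) (5.3) with proof, chunk p0011] -/
theorem div_self_le_mul_div_mul (P Q : Submodule ℤ A) : P / P ≤ (Q * P) / (Q * P) :=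
  Submodule.le_div_iff_mul_le.2 <| by
    rw [mul_left_comm]
    exact mul_le_mul' le_rfl (Submodule.le_div_iff_mul_le.1 le_rfl)

omit [Algebra ℚ A] [Module.Finite ℚ A] in
/-- `𝒪(M) ⊆ 𝒪(M^k)` for `k ≥ 1`. [cite: HertlingLarabi2026, §5 Lemma 5.3 (b) (5.3), chunk p0011; §10 Thm. 10.3 (c)(ii) («`Λ_2 ⊃ 𝒪(L)`»), chunk p0027] -/
theorem div_self_le_pow_div_pow (M : Submodule ℤ A) {k : ℕ} (hk : 1 ≤ k) : M / M ≤ M ^ k / M ^ k := by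
  obtain ⟨j, rfl⟩ := Nat.exists_eq_add_of_le' hk
  rw [pow_succ]
  exact div_self_le_mul_div_mul M (M ^ j)

omit [Algebra ℚ A] [Module.Finite ℚ A] in
/-- **`G(Λ)` IS CLOSED UNDER PRODUCTS, general `A`: `𝒪(M) = Λ`, `M·(Λ:M) = Λ = N·(Λ:N)` ⟹ `𝒪(MN) = Λ` and
`MN·(Λ:MN) = Λ`** (`MN·(Λ:M)(Λ:N) = ΛΛ = Λ`; `𝒪(MN) ⊇ Λ` as `ΛMN = MN`, and `𝒪(MN) = 𝒪(MN)·MN(Λ:M)(Λ:N) ⊆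
MN(Λ:M)(Λ:N) = Λ`; the hypothesis `𝒪(N) = Λ` of «`N ∈ G(Λ)`» is not needed; «for each idempotent `c` the set `G(c)`
[…] is a group with unit element `c`»).
[cite: HertlingLarabi2026, §1 (definition of `G(c)`), chunk p0003; §5 Thm. 5.6, chunk p0012] -/
theorem mul_div_mul_eq_and_mul_inv_eq_of_invertible {M N Λ : Submodule ℤ A} (hMO : M / M = Λ)
    (hMi : M * (Λ / M) = Λ) (hNi : N * (Λ / N) = Λ) :
    (M * N) / (M * N) = Λ ∧ (M * N) * (Λ / (M * N)) = Λ := by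
  have h1Λ : (1 : A) ∈ Λ := by rw [← hMO]; exact one_mem_div_self M
  have hΛΛ : Λ * Λ = Λ := by
    have h := div_self_mul_div_self M
    rwa [hMO] at h
  have hΛM : Λ * M = M := by rw [← hMO]; exact div_self_mul_eq_self M
  -- `MN·((Λ:M)(Λ:N)) = Λ`
  have hprod : (M * N) * ((Λ / M) * (Λ / N)) = Λ := by
    calc (M * N) * ((Λ / M) * (Λ / N)) = (M * (Λ / M)) * (N * (Λ / N)) := by ring
      _ = Λ := by rw [hMi, hNi, hΛΛ]
  -- `Λ ⊆ 𝒪(MN)`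
  have hle : Λ ≤ (M * N) / (M * N) := Submodule.le_div_iff_mul_le.2 (by rw [← mul_assoc, hΛM])
  -- `𝒪(MN) ⊆ Λ`
  have hge : (M * N) / (M * N) ≤ Λ := fun x hx => by
    have h2 : x * 1 ∈ ((M * N) / (M * N)) * Λ := Submodule.mul_mem_mul hx h1Λ
    rw [mul_one, ← hprod, ← mul_assoc, div_self_mul_eq_self] at h2
    rwa [← hprod]
  have hO : (M * N) / (M * N) = Λ := le_antisymm hge hle
  refine ⟨hO, le_antisymm ?_ ?_⟩
  · -- `MN·(𝒪(MN):MN) ⊆ 𝒪(MN)` always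
    rw [← hO]
    exact mul_div_div_le _
  · calc Λ = (M * N) * ((Λ / M) * (Λ / N)) := hprod.symm
      _ ≤ (M * N) * (Λ / (M * N)) := mul_le_mul' le_rfl (Submodule.le_div_iff_mul_le.2 (by
          rw [mul_comm, hprod]))

omit [Algebra ℚ A] [Module.Finite ℚ A] in
/-- **Powers stay in `G(Λ)`: `ΛM ∈ G(Λ)` ⟹ `ΛM^{j+1} = (ΛM)^{j+1} ∈ G(Λ)`**, i.e. `𝒪(ΛM^{j+1}) = Λ` and
`ΛM^{j+1}·(Λ:ΛM^{j+1}) = Λ`. [cite: HertlingLarabi2026, §1 (definition of `G(c)`: «is a group»), chunk p0003] -/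
theorem order_mul_pow_succ_mem_G {M Λ : Submodule ℤ A} (h1Λ : (1 : A) ∈ Λ) (hΛΛ : Λ * Λ ≤ Λ)
    (hO : (Λ * M) / (Λ * M) = Λ) (hinv : (Λ * M) * (Λ / (Λ * M)) = Λ) :
    ∀ j : ℕ, (Λ * M ^ (j + 1)) / (Λ * M ^ (j + 1)) = Λ ∧ (Λ * M ^ (j + 1)) * (Λ / (Λ * M ^ (j + 1))) = Λ
  | 0 => by rw [zero_add, pow_one]; exact ⟨hO, hinv⟩
  | j + 1 => by
    obtain ⟨hOj, hinvj⟩ := order_mul_pow_succ_mem_G h1Λ hΛΛ hO hinv j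
    have hprod : Λ * M ^ (j + 1 + 1) = (Λ * M ^ (j + 1)) * (Λ * M) := by
      calc Λ * M ^ (j + 1 + 1) = (Λ * Λ) * (M ^ (j + 1) * M) := by rw [mul_self_eq_of_one_mem h1Λ hΛΛ, ← pow_succ]
        _ = (Λ * M ^ (j + 1)) * (Λ * M) := by ring
    rw [hprod]
    exact mul_div_mul_eq_and_mul_inv_eq_of_invertible hOj hinvj hinv

omit [Algebra ℚ A] [Module.Finite ℚ A] in
/-- **MINIMALITY ∕ THE HYPOTHESIS `Λ ⊃ 𝒪(L)` IS AUTOMATIC: if `Λ` is an order with `ΛM ∈ G(Λ)`, then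
`𝒪(M^j) ⊆ Λ` for EVERY `j ≥ 1`** — `j = 1`: `𝒪(M) ⊆ Λ`; `j ≥ dim_ℚ A − 1`: HL's `Λ_2 = 𝒪(M^{n−1+l}) ⊆ Λ`
(`𝒪(M^j) ⊆ 𝒪(ΛM^j) = Λ`, the latter as `ΛM^j = (ΛM)^j ∈ G(Λ)`). [cite: HertlingLarabi2026, §10 Thm. 10.2 and the end of the proof of Thm. 10.1 («`𝒪(L^{n−1+l}) = Λ_2`», `Λ_2 = L_2^N ⊂ Λ`), chunks p0026–p0028] -/
theorem pow_div_pow_le_of_order_mul_mem_G {M Λ : Submodule ℤ A} (h1Λ : (1 : A) ∈ Λ) (hΛΛ : Λ * Λ ≤ Λ)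
    (hO : (Λ * M) / (Λ * M) = Λ) (hinv : (Λ * M) * (Λ / (Λ * M)) = Λ) {j : ℕ} (hj : 1 ≤ j) :
    M ^ j / M ^ j ≤ Λ := by
  obtain ⟨i, rfl⟩ := Nat.exists_eq_add_of_le' hj
  calc M ^ (i + 1) / M ^ (i + 1) ≤ (Λ * M ^ (i + 1)) / (Λ * M ^ (i + 1)) := div_self_le_mul_div_mul _ _
    _ = Λ := (order_mul_pow_succ_mem_G h1Λ hΛΛ hO hinv i).1

omit [Algebra ℚ A] [Module.Finite ℚ A] in
/-- In particular (`j = 1`): **`ΛL ∈ G(Λ)` already forces `Λ ⊃ 𝒪(L)`** — the first hypothesis of Thm. 10.2 ∕ 10.3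
follows from the second. [cite: HertlingLarabi2026, §10 Thm. 10.2, chunk p0026] -/
theorem div_self_le_of_order_mul_mem_G {M Λ : Submodule ℤ A} (h1Λ : (1 : A) ∈ Λ) (hΛΛ : Λ * Λ ≤ Λ)
    (hO : (Λ * M) / (Λ * M) = Λ) (hinv : (Λ * M) * (Λ / (Λ * M)) = Λ) : M / M ≤ Λ := by
  have h := pow_div_pow_le_of_order_mul_mem_G h1Λ hΛΛ hO hinv le_rfl
  rwa [pow_one] at h

omit [Algebra ℚ A] [Module.Finite ℚ A] in
/-- **`𝒪(Λ_2M) = Λ_2` for `Λ_2 = 𝒪(M^k)`, any `M` and any `k ≥ 1`** (`⊇`: `Λ_2` is idempotent; `⊆`: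
`𝒪(Λ_2M)·M^k = 𝒪(Λ_2M)·Λ_2M·M^{k−1} ⊆ Λ_2M·M^{k−1} = Λ_2M^k = M^k`). [cite: HertlingLarabi2026, §10 Thm. 10.2 («so `𝒪(ΛL) = Λ`»), chunk p0026] -/
theorem pow_div_pow_mul_div_self_eq {M : Submodule ℤ A} {k : ℕ} (hk1 : 1 ≤ k) :
    (M ^ k / M ^ k * M) / (M ^ k / M ^ k * M) = M ^ k / M ^ k := by
  obtain ⟨i, rfl⟩ := Nat.exists_eq_add_of_le' hk1
  refine le_antisymm (Submodule.le_div_iff_mul_le.2 ?_)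
    (Submodule.le_div_iff_mul_le.2 (by rw [← mul_assoc, div_self_mul_div_self]))
  have hOM : M ^ (i + 1) / M ^ (i + 1) * M ^ (i + 1) = M ^ (i + 1) := div_self_mul_eq_self _
  calc (M ^ (i + 1) / M ^ (i + 1) * M) / (M ^ (i + 1) / M ^ (i + 1) * M) * M ^ (i + 1)
        = (M ^ (i + 1) / M ^ (i + 1) * M) / (M ^ (i + 1) / M ^ (i + 1) * M) *
            (M ^ (i + 1) / M ^ (i + 1) * M ^ (i + 1)) := by rw [hOM]
    _ = (M ^ (i + 1) / M ^ (i + 1) * M) / (M ^ (i + 1) / M ^ (i + 1) * M) *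
            (M ^ (i + 1) / M ^ (i + 1) * M) * M ^ i := by ring
    _ ≤ (M ^ (i + 1) / M ^ (i + 1) * M) * M ^ i :=
          mul_le_mul' (Submodule.le_div_iff_mul_le.1 le_rfl) le_rfl
    _ = M ^ (i + 1) / M ^ (i + 1) * M ^ (i + 1) := by ring
    _ = M ^ (i + 1) := hOM

/-- **`Λ_2M` IS INVERTIBLE, `Λ_2M·(Λ_2:Λ_2M) = Λ_2`, for `Λ_2 = 𝒪(M^k)`, `M` full, `k ≥ dim_ℚ A − 1`, `k ≥ 1`**
(`Λ_2M·(M^{k−1}(Λ_2:M^k)) = Λ_2·M^k(Λ_2:M^k) = Λ_2Λ_2 = Λ_2 = 𝒪(Λ_2M)` by Thm. 10.1, then Thm. 5.6 (c)).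
[cite: HertlingLarabi2026, §10 Thm. 10.2 («and `ΛL` invertible»), chunk p0026; §5 Thm. 5.6 (c), chunk p0012] -/
theorem pow_div_pow_mul_mul_inv_eq {M : Submodule ℤ A} (hM : IsFullLattice A M) {k : ℕ} (hk : finrank ℚ A - 1 ≤ k)
    (hk1 : 1 ≤ k) : (M ^ k / M ^ k * M) * ((M ^ k / M ^ k) / (M ^ k / M ^ k * M)) = M ^ k / M ^ k := by
  have hOO := pow_div_pow_mul_div_self_eq (M := M) hk1
  obtain ⟨i, rfl⟩ := Nat.exists_eq_add_of_le' hk1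
  have h := mul_div_div_eq_of_exists_mul_eq_div_self (M := M ^ (i + 1) / M ^ (i + 1) * M)
    ⟨M ^ i * ((M ^ (i + 1) / M ^ (i + 1)) / M ^ (i + 1)), ?_⟩
  · rwa [hOO] at h
  · rw [hOO]
    calc M ^ (i + 1) / M ^ (i + 1) * M * (M ^ i * ((M ^ (i + 1) / M ^ (i + 1)) / M ^ (i + 1)))
          = M ^ (i + 1) / M ^ (i + 1) * (M ^ (i + 1) * ((M ^ (i + 1) / M ^ (i + 1)) / M ^ (i + 1))) := by ring
      _ = M ^ (i + 1) / M ^ (i + 1) := by rw [pow_mul_div_div_eq_of_isFullLattice hM hk, div_self_mul_div_self]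

/-- **HERTLING–LARABI THEOREM 10.2 FOR AN ARBITRARY FINITE-DIMENSIONAL COMMUTATIVE `ℚ`-ALGEBRA `A`, WITH THE MINIMAL
ORDER: for every full lattice `M` of `A` there is an order `Λ` — a full lattice with `1_A ∈ Λ = ΛΛ` — with
`Λ ⊃ 𝒪(M)`, `𝒪(ΛM) = Λ` and `ΛM` invertible (`ΛM ∈ G(Λ)`), which is moreover contained in every order `Λ'` with
`Λ'M ∈ G(Λ')`; namely `Λ = Λ_2 = 𝒪(M^k)` for any `k ≥ max(1, dim_ℚ A − 1)`** («An order `Λ ⊃ 𝒪(L)` with `ΛL ∈ G(Λ)`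
(so `𝒪(ΛL) = Λ` and `ΛL` invertible) exists»; the minimality is the clause `Λ_2 ⊂ Λ` of HL's proof of Thm. 10.1).
[cite: HertlingLarabi2026, §10 Thm. 10.2, chunk p0026, and end of the proof of Thm. 10.1, chunk p0028]
[cite: DadeTausskyZassenhaus1962, §1.3 and §1.5 Theorem C (as cited by HertlingLarabi2026 §10)] -/
theorem exists_minimal_order_mul_mem_G {M : Submodule ℤ A} (hM : IsFullLattice A M) :
    ∃ Λ : Submodule ℤ A, IsFullLattice A Λ ∧ (1 : A) ∈ Λ ∧ Λ * Λ = Λ ∧ M / M ≤ Λ ∧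
      (Λ * M) / (Λ * M) = Λ ∧ (Λ * M) * (Λ / (Λ * M)) = Λ ∧
      ∀ Λ' : Submodule ℤ A, (1 : A) ∈ Λ' → Λ' * Λ' ≤ Λ' → (Λ' * M) / (Λ' * M) = Λ' →
        (Λ' * M) * (Λ' / (Λ' * M)) = Λ' → Λ ≤ Λ' := by
  obtain ⟨k, hk1, hk⟩ : ∃ k : ℕ, 1 ≤ k ∧ finrank ℚ A - 1 ≤ k :=
    ⟨max 1 (finrank ℚ A - 1), le_max_left _ _, le_max_right _ _⟩
  refine ⟨M ^ k / M ^ k, ?_, one_mem_div_self _, div_self_mul_div_self _, div_self_le_pow_div_pow M hk1,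
    pow_div_pow_mul_div_self_eq hk1, pow_div_pow_mul_mul_inv_eq hM hk hk1, fun Λ' h1 hmul hO hinv =>
    pow_div_pow_le_of_order_mul_mem_G h1 hmul hO hinv hk1⟩
  obtain ⟨i, rfl⟩ := Nat.exists_eq_add_of_le' hk1
  exact isFullLattice_div (isFullLattice_pow_succ hM i) (isFullLattice_pow_succ hM i)

/-- **THEOREM 10.2 AS PRINTED (existence only), general `A`.** [cite: HertlingLarabi2026, §10 Thm. 10.2, chunk p0026] -/
theorem exists_order_mul_mem_G {M : Submodule ℤ A} (hM : IsFullLattice A M) :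
    ∃ Λ : Submodule ℤ A, IsFullLattice A Λ ∧ (1 : A) ∈ Λ ∧ Λ * Λ = Λ ∧ M / M ≤ Λ ∧
      (Λ * M) / (Λ * M) = Λ ∧ (Λ * M) * (Λ / (Λ * M)) = Λ := by
  obtain ⟨Λ, hΛ, h1, hΛΛ, hO, hOO, hinv, -⟩ := exists_minimal_order_mul_mem_G hM
  exact ⟨Λ, hΛ, h1, hΛΛ, hO, hOO, hinv⟩

/-- **With Theorem 10.3 (c)(d): if moreover `1_A ∈ M ⊆ Λ'` for some order `Λ'`, the minimal order of Thm. 10.2 is the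
power `M^k` itself** (`k ≥ max(1, dim_ℚ A − 1)`): `𝒪(M^kM) = M^k` and `M^kM = M^k` is invertible.
[cite: HertlingLarabi2026, §10 Thm. 10.2 with Thm. 10.3 (c)(d), chunks p0026–p0028] -/
theorem pow_mul_mem_G_of_one_mem_le_order {M Λ : Submodule ℤ A} (hM : IsFullLattice A M) (h1 : (1 : A) ∈ M)
    (hΛ : Λ.FG) (hΛΛ : Λ * Λ ≤ Λ) (hMΛ : M ≤ Λ) {k : ℕ} (hk : finrank ℚ A - 1 ≤ k) :
    M ^ k * M = M ^ k ∧ (M ^ k * M) / (M ^ k * M) = M ^ k ∧ (M ^ k * M) * (M ^ k / (M ^ k * M)) = M ^ k := by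
  obtain ⟨-, hkk, hMk, hOk, -, -⟩ := pow_isOrder_of_one_mem_le_order hM h1 hΛ hΛΛ hMΛ hk
  have hkM : M ^ k * M = M ^ k := by rw [mul_comm, hMk]
  refine ⟨hkM, ?_, ?_⟩
  · rw [hkM, hOk]
  · rw [hkM, hOk, hkk]

/-! ## §7 HL26 Lemma 4.6 for general `A` — the powers below the stationary one are not invertible — and WHEN a
lattice containing `1_A` lies in an order (row g35-#2)

C. Hertling, K. Larabi, *Conjugacy classes of regular integer matrices*, arXiv:2602.15748 (2026) [HertlingLarabi2026b],
Lemma 4.6 (chunk p0007), for a full lattice `L ∋ 1_A` inside an order: the chain `L ⊊ L² ⊊ ⋯ ⊊ L^l = L^{l+1} = ⋯`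
ends at an order `L^l`, and «If for some `j ∈ {1,…,l−1}` `L^j` were invertible, then `𝒪(L^j) = 𝒪(L^{jm}) =
𝒪(L^l) = L^l` for `jm ≥ l`, so `L^j = L^j·𝒪(L^j) = L^{j+l} = L^l`, a contradiction.»  The `Y`-series has this
as `CMAlgebraLatticePowersInvertible.pow_mul_div_div_ne_of_ne_pow`; here for general `A` — indeed for any
commutative ring, with no fullness hypothesis — through §6's `G(Λ)`-product lemma.  Then the minimal stationary
index `N` of HL 2026 Thm. 10.3 (c)(i) («so there is a minimal number `N ∈ ℕ` with `L_2^N = L_2^{N+l}` for each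
`l ≥ 0`», «(d) `N ≤ n−1`») in `Nat.find` form, and the equivalence, for `1_A ∈ M`, of: `M` lies in some order;
the chain of powers is stationary; (for `M` full, `n = dim_ℚ A ≥ 2`) `M·M^{n−1} = M^{n−1}`; `M^{n−1}` is an order
— conditions which may fail (`A = ℚ²`, `M = ℤ(1,1) + ℤ(½,0)`: `M^j ∋ (2^{−j}, 0)` is unbounded). -/

omit [Algebra ℚ A] [Module.Finite ℚ A] in
/-- `M ⊆ M^N` at a stationary exponent (also for `N = 0`: then `M = M^1 = M^0`).
[cite: HertlingLarabi2026, §10 Thm. 10.3 (c), chunk p0027] -/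
theorem le_pow_of_forall_pow_add_eq {M : Submodule ℤ A} (h1 : (1 : A) ∈ M) {N : ℕ}
    (hstab : ∀ l : ℕ, M ^ (N + l) = M ^ N) : M ≤ M ^ N :=
  calc M = M ^ 1 := (pow_one M).symm
    _ ≤ M ^ (N + 1) := pow_le_pow_of_one_mem h1 (Nat.le_add_left 1 N)
    _ = M ^ N := hstab 1

omit [Algebra ℚ A] [Module.Finite ℚ A] in
/-- **One equality `M^{j+1} = M^j` makes the chain stationary from `j` on** (`M^{j+l+1} = M^{j+l}·M = M^j·M = M^j`).
[cite: HertlingLarabi2026, §10 Thm. 10.3 (d) (proof: «if for some `m` […] `= (L_2^{m+1}+pΛ_2)/pΛ_2`, then […] for each `l ≥ 1`»), chunk p0028] -/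
theorem forall_pow_add_eq_of_pow_succ_eq {M : Submodule ℤ A} {j : ℕ} (h : M ^ (j + 1) = M ^ j) :
    ∀ l : ℕ, M ^ (j + l) = M ^ j
  | 0 => by rw [add_zero]
  | l + 1 => by rw [← add_assoc, pow_succ, forall_pow_add_eq_of_pow_succ_eq h l, ← pow_succ, h]

omit [Algebra ℚ A] [Module.Finite ℚ A] in
/-- **HL26 LEMMA 4.6 (last clause) for general `A`: the powers `M^j`, `j ≥ 1`, different from the stationary power
are NOT invertible** — if `M^j·(𝒪(M^j):M^j) = 𝒪(M^j)` then all `(M^j)^{m+1}` lie in the group `G(𝒪(M^j))` (§6),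
so `𝒪(M^j) = 𝒪(M^{j(N+1)}) = 𝒪(M^N) = M^N` and `M^j = 𝒪(M^j)M^j = M^{N+j} = M^N` («`𝒪(L^j) = 𝒪(L^{jm}) = 𝒪(L^l) =
L^l` for `jm ≥ l`, so `L^j = L^j·𝒪(L^j) = L^{j+l} = L^l`, a contradiction»).  Any commutative ring, `1_A ∈ M`, no
fullness needed. [cite: HertlingLarabi2026b, Lemma 4.6, chunk p0007] [cite: HertlingLarabi2026, §10 Thm. 10.3 (c), chunk p0027] -/
theorem pow_mul_div_div_ne_of_ne_pow {M : Submodule ℤ A} (h1 : (1 : A) ∈ M) {N : ℕ}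
    (hstab : ∀ l : ℕ, M ^ (N + l) = M ^ N) {j : ℕ} (hj : 1 ≤ j) (hne : M ^ j ≠ M ^ N) :
    M ^ j * ((M ^ j / M ^ j) / M ^ j) ≠ M ^ j / M ^ j := by
  intro hinv
  -- all the powers `(M^j)^{m+1}` lie in `G(𝒪(M^j))`
  have hpow : ∀ m : ℕ, (M ^ j) ^ (m + 1) / (M ^ j) ^ (m + 1) = M ^ j / M ^ j ∧
      (M ^ j) ^ (m + 1) * ((M ^ j / M ^ j) / (M ^ j) ^ (m + 1)) = M ^ j / M ^ j := by
    intro m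
    induction m with
    | zero => rw [zero_add, pow_one]; exact ⟨rfl, hinv⟩
    | succ m ih =>
      rw [pow_succ]
      exact mul_div_mul_eq_and_mul_inv_eq_of_invertible ih.1 ih.2 hinv
  obtain ⟨hO, -⟩ := hpow N
  have hle : N ≤ j * (N + 1) := (Nat.le_succ N).trans (Nat.le_mul_of_pos_left (N + 1) hj)
  rw [← pow_mul, pow_eq_pow_of_le hstab hle, (pow_isOrder_of_forall_pow_add_eq h1 hstab).2.2.2] at hO
  -- `hO : M^N = 𝒪(M^j)`, so `M^j = 𝒪(M^j)·M^j = M^{N+j} = M^N`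
  apply hne
  calc M ^ j = (M ^ j / M ^ j) * M ^ j := (div_self_mul_eq_self _).symm
    _ = M ^ N * M ^ j := by rw [← hO]
    _ = M ^ (N + j) := (pow_add _ _ _).symm
    _ = M ^ N := hstab j

omit [Algebra ℚ A] [Module.Finite ℚ A] in
/-- **The MINIMAL stationary index** («so there is a minimal number `N ∈ ℕ` with `L_2^N = L_2^{N+l}` for each
`l ≥ 0`»): below it the chain is STRICTLY increasing, `M^j ≠ M^{j+1}` for `j < N`.
[cite: HertlingLarabi2026, §10 Thm. 10.3 (c)(i), chunk p0027] [cite: HertlingLarabi2026b, Lemma 4.6, chunk p0007] -/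
theorem pow_ne_pow_succ_of_lt_find {M : Submodule ℤ A} (h : ∃ N : ℕ, ∀ l : ℕ, M ^ (N + l) = M ^ N) {j : ℕ}
    (hj : j < Nat.find h) : M ^ j ≠ M ^ (j + 1) := fun heq =>
  Nat.find_min h hj (forall_pow_add_eq_of_pow_succ_eq heq.symm)

omit [Algebra ℚ A] [Module.Finite ℚ A] in
/-- Below the minimal stationary index the powers differ from the stationary one: `M^j ≠ M^N` for `j < N`
(`1_A ∈ M`: else `M^j = M^{j+1} = M^N` by monotonicity). [cite: HertlingLarabi2026, §10 Thm. 10.3 (c)(i), chunk p0027] -/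
theorem pow_ne_pow_find_of_lt_find {M : Submodule ℤ A} (h1 : (1 : A) ∈ M)
    (h : ∃ N : ℕ, ∀ l : ℕ, M ^ (N + l) = M ^ N) {j : ℕ} (hj : j < Nat.find h) : M ^ j ≠ M ^ Nat.find h := by
  intro heq
  refine pow_ne_pow_succ_of_lt_find h hj (le_antisymm (pow_le_pow_succ_of_one_mem h1 j) ?_)
  calc M ^ (j + 1) ≤ M ^ Nat.find h := pow_le_pow_of_one_mem h1 hj
    _ = M ^ j := heq.symm

omit [Algebra ℚ A] [Module.Finite ℚ A] in
/-- **HL26 LEMMA 4.6 with the minimal index: `M^j` is NOT invertible for `1 ≤ j < N`**, `N` the minimal stationary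
index («If for some `j ∈ {1,…,l−1}` `L^j` were invertible […] a contradiction»). [cite: HertlingLarabi2026b, Lemma 4.6, chunk p0007] -/
theorem pow_mul_div_div_ne_of_lt_find {M : Submodule ℤ A} (h1 : (1 : A) ∈ M)
    (h : ∃ N : ℕ, ∀ l : ℕ, M ^ (N + l) = M ^ N) {j : ℕ} (hj1 : 1 ≤ j) (hj : j < Nat.find h) :
    M ^ j * ((M ^ j / M ^ j) / M ^ j) ≠ M ^ j / M ^ j :=
  pow_mul_div_div_ne_of_ne_pow h1 (Nat.find_spec h) hj1 (pow_ne_pow_find_of_lt_find h1 h hj)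

/-- **HL THM. 10.3 (d) in `Nat.find` form: the minimal stationary index is `≤ dim_ℚ A − 1`** for a full `M` with
`1_A ∈ M ⊆ Λ`, `Λ` an order («(d) In part (c) `N ≤ n−1`»). [cite: HertlingLarabi2026, §10 Thm. 10.3 (d), chunks p0027–p0028] -/
theorem find_le_finrank_sub_one {M Λ : Submodule ℤ A} (hM : IsFullLattice A M) (h1 : (1 : A) ∈ M) (hΛ : Λ.FG)
    (hΛΛ : Λ * Λ ≤ Λ) (hMΛ : M ≤ Λ) (h : ∃ N : ℕ, ∀ l : ℕ, M ^ (N + l) = M ^ N) :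
    Nat.find h ≤ finrank ℚ A - 1 :=
  Nat.find_le fun l => by
    rw [pow_eq_pow_finrank_sub_one_of_one_mem_le_order hM h1 hΛ hΛΛ hMΛ (Nat.le_add_right _ l)]

omit [Algebra ℚ A] [Module.Finite ℚ A] in
/-- **WHEN DOES A LATTICE CONTAINING `1_A` LIE IN AN ORDER? Iff its chain of powers is stationary** — then the
stationary power `M^N ⊇ M` is such an order (any commutative ring; `M` finitely generated).
[cite: HertlingLarabi2026, §10 Thm. 10.3 (c)(i)–(ii), chunks p0027–p0028] -/
theorem exists_le_order_iff_exists_forall_pow_add_eq {M : Submodule ℤ A} (hM : M.FG) (h1 : (1 : A) ∈ M) :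
    (∃ Λ : Submodule ℤ A, Λ.FG ∧ Λ * Λ ≤ Λ ∧ M ≤ Λ) ↔ ∃ N : ℕ, ∀ l : ℕ, M ^ (N + l) = M ^ N := by
  constructor
  · rintro ⟨Λ, hΛ, hΛΛ, hMΛ⟩
    exact exists_forall_pow_add_eq hΛ (hMΛ h1) hΛΛ h1 hMΛ
  · rintro ⟨N, hstab⟩
    exact ⟨M ^ N, hM.pow N, (pow_isOrder_of_forall_pow_add_eq h1 hstab).2.1.le, le_pow_of_forall_pow_add_eq h1 hstab⟩

/-- **For a FULL lattice `M ∋ 1_A`, `n = dim_ℚ A ≥ 2`: `M` lies in an order ⟺ `M·M^{n−1} = M^{n−1}`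
(`M ⊆ 𝒪(M^{n−1})`) ⟺ `M^{n−1}` is an order (`M^{n−1}M^{n−1} = M^{n−1}`)** — and then `M^{n−1} = 𝒪(M^{n−1})` is the
smallest order containing `M` (every order `Λ ⊇ M` contains all `M^k`).  These may fail: in `A = ℚ²` the full
lattice `M = ℤ(1,1) + ℤ(½,0) ∋ 1_A` has `(2^{−j}, 0) ∈ M^j`, unbounded.
[cite: HertlingLarabi2026, §10 Thm. 10.3 (c)(d), chunks p0027–p0028] [cite: HertlingLarabi2026b, Lemma 4.6, chunk p0007] -/
theorem exists_le_order_iff_mul_pow_eq_pow {M : Submodule ℤ A} (hM : IsFullLattice A M) (h1 : (1 : A) ∈ M)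
    (hn : 2 ≤ finrank ℚ A) :
    ((∃ Λ : Submodule ℤ A, Λ.FG ∧ Λ * Λ ≤ Λ ∧ M ≤ Λ) ↔ M * M ^ (finrank ℚ A - 1) = M ^ (finrank ℚ A - 1)) ∧
    ((∃ Λ : Submodule ℤ A, Λ.FG ∧ Λ * Λ ≤ Λ ∧ M ≤ Λ) ↔
      M ^ (finrank ℚ A - 1) * M ^ (finrank ℚ A - 1) = M ^ (finrank ℚ A - 1)) ∧
    ∀ Λ : Submodule ℤ A, Λ * Λ ≤ Λ → M ≤ Λ → M ^ (finrank ℚ A - 1) ≤ Λ := by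
  have hMle : M ≤ M ^ (finrank ℚ A - 1) := by
    calc M = M ^ 1 := (pow_one M).symm
      _ ≤ M ^ (finrank ℚ A - 1) := pow_le_pow_of_one_mem h1 (by omega)
  have hfg : (M ^ (finrank ℚ A - 1)).FG := hM.1.pow _
  refine ⟨⟨fun ⟨Λ, hΛ, hΛΛ, hMΛ⟩ => (pow_isOrder_of_one_mem_le_order hM h1 hΛ hΛΛ hMΛ le_rfl).2.2.1,
    fun h => ⟨M ^ (finrank ℚ A - 1), hfg, ?_, hMle⟩⟩,
    ⟨fun ⟨Λ, hΛ, hΛΛ, hMΛ⟩ => (pow_isOrder_of_one_mem_le_order hM h1 hΛ hΛΛ hMΛ le_rfl).2.1,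
    fun h => ⟨M ^ (finrank ℚ A - 1), hfg, h.le, hMle⟩⟩,
    fun Λ hΛΛ hMΛ => pow_le_of_le_order (hMΛ h1) hΛΛ hMΛ _⟩
  -- `M·M^{n−1} = M^{n−1}` ⟹ `M^j·M^{n−1} = M^{n−1}` for all `j`, in particular `M^{n−1}M^{n−1} = M^{n−1}`
  have key : ∀ j : ℕ, M ^ j * M ^ (finrank ℚ A - 1) = M ^ (finrank ℚ A - 1) := fun j => by
    induction j with
    | zero => rw [pow_zero, one_mul]
    | succ j ih => rw [pow_succ, mul_assoc, h, ih]
  exact (key _).le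

/-- The same with the stationarity of the chain: for a full `M ∋ 1_A` (`n ≥ 2`) the chain `M ⊆ M² ⊆ ⋯` is
stationary iff `M·M^{n−1} = M^{n−1}`, and then it is stationary from `n − 1` on.
[cite: HertlingLarabi2026, §10 Thm. 10.3 (c)(d), chunks p0027–p0028] -/
theorem exists_forall_pow_add_eq_iff_mul_pow_eq_pow {M : Submodule ℤ A} (hM : IsFullLattice A M) (h1 : (1 : A) ∈ M)
    (hn : 2 ≤ finrank ℚ A) :
    (∃ N : ℕ, ∀ l : ℕ, M ^ (N + l) = M ^ N) ↔ M * M ^ (finrank ℚ A - 1) = M ^ (finrank ℚ A - 1) := by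
  rw [← exists_le_order_iff_exists_forall_pow_add_eq hM.1 h1]
  exact (exists_le_order_iff_mul_pow_eq_pow hM h1 hn).1

/-- … and then `M^{n−1+l} = M^{n−1}` for all `l`: the chain is stationary from `n − 1` on.
[cite: HertlingLarabi2026, §10 Thm. 10.3 (d), chunk p0028] -/
theorem forall_pow_finrank_sub_one_add_eq_of_mul_pow_eq_pow {M : Submodule ℤ A} (hM : IsFullLattice A M)
    (h1 : (1 : A) ∈ M) (hn : 2 ≤ finrank ℚ A) (h : M * M ^ (finrank ℚ A - 1) = M ^ (finrank ℚ A - 1)) :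
    ∀ l : ℕ, M ^ (finrank ℚ A - 1 + l) = M ^ (finrank ℚ A - 1) := fun l => by
  obtain ⟨Λ, hΛ, hΛΛ, hMΛ⟩ := (exists_le_order_iff_mul_pow_eq_pow hM h1 hn).1.2 h
  exact pow_eq_pow_finrank_sub_one_of_one_mem_le_order hM h1 hΛ hΛΛ hMΛ (Nat.le_add_right _ l)

end Literature.NumberTheory.ComplexMultiplication.FiniteQAlgebraLattice
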